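import Literature.Probability.Percolation.StarTriangleMoves
import Literature.Probability.Percolation.StarTriangleIsoradial
import Literature.Probability.Percolation.IsoradialSquareLatticeGM
import HarnessLib

/-!
# Track exchange in a strip of an isoradial square lattice: the stages and the two moves

Grimmett–Manolescu, *Bond percolation on isoradial graphs* (PTRF 159 (2014) 273–327 =
arXiv:1204.0505), §5.3 "Track-exchange in an isoradial square lattice": in the vertical strip
`{v_{i,j} : -M ≤ i ≤ M}` of the isoradial square lattice `G_{α,β}` (§4.6: columns `t_i` with
angles `α_i`, rows `s_j` with angles `β_j`, the rhombus of `t_i, s_j` has angles `β_j - α_i` and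
`π - (β_j - α_i)`), the tracks at levels `j - 1` and `j` are exchanged by inserting a rhombus at
the side of the strip, sliding it through the strip by `2M` star–triangle transformations
("This creates a hexagon in `G^◇`, containing either a triangle or a star of `G`. The
star–triangle transformation is applied within this hexagon, thereby moving the new rhombus to
the right"), and removing it at the other side; `Σ_j(G_{α,β}, P_{α,β}) = (G_{α,σ_jβ}, P_{α,σ_jβ})`.
The same chain is the track-exchange operator of Duminil-Copin–Kozlowski–Krachun–Manolescu–Oulamara
(arXiv:2012.11672v2, §2.6). This file writes the chain down **combinatorially, by its weights**, so
that every step is literally an instance of the moves of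
`Literature.Probability.Percolation.StarTriangleMoves` (`afterMove`, `connEquiv_relabel`,
pendant edges), with the self-duality `κ_△ = 0` of every triangle met along the way proved.

## The combinatorial model (no positions are needed)

* Vertices `SV = Option (ℤ × ℤ)`: the diamond-graph points `(i, y)` (column `i`, height `y`; the
  vertex is *primal* iff `i + y` is even — GM14's `v_{i,j}`; the tree's DKKMO file
  `MixedIsoradialLattice` uses `Site 2` with `(x, y) ↦ (i, j) = (x - y, x + y)`, the same
  lattice) and the travelling vertex `⋆ = none`.
* `angleWeight θ = p_θ` (GM14 (2.3), `= criticalWeightI ((π-θ)/2)` in the tree's half-angle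
  convention), `coe_angleWeight_add_coe_angleWeight_pi_sub` (`p_θ + p_{π-θ} = 1`),
  `kappa_angleWeight_eq_zero` (a triangle whose edges subtend `θ₀ + θ₁ + θ₂ = 2π` at the
  circumcentre is self-dual — the tree's `kappa_criticalWeight_eq_zero`).
* `canonicalWeight M Θ`: the rhombus `R_{i,y}` (corners `(i,y), (i+1,y), (i,y+1), (i+1,y+1)`,
  angle `Θ i y` at `(i,y)` and `(i+1,y+1)` — the convention of the tree's
  `IsoradialSquareLatticeGM` (`gmDartAngle`: the rhombus of `t_i, s_j` has angle `β_j - α_i` at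
  `v_{i,j}` and `v_{i+1,j+1}`), forced by the positions `v_{i+1,y} - v_{i,y} = e^{iα_i}`,
  `v_{i,y+1} - v_{i,y} = e^{iβ_y}`), present for `-M ≤ i < M`, weights its primal diagonal by
  `p_θ` with `θ` the angle at its two *dual* corners: `(i,y)–(i+1,y+1)` by
  `p_{π-Θ} = criticalWeightI (Θ/2)` if `i + y` is even, `(i+1,y)–(i,y+1)` by
  `p_Θ = criticalWeightI ((π-Θ)/2)` if `i + y` is odd. With `Θ i y = β_y - α_i` this is `P_{α,β}`
  on the strip (`ExchangeData.initial`); `canonicalWeight_map_gmLabel` is the dictionary with the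
  tree's `gmWeight α β` along `(x, y) ↦ v_{x-y, x+y}`.
* The stages of `Σ_j` (`ExchangeData.stage`): rows `B_i = (i,j-1)`, `T_i = (i,j+1)`, old middle
  vertices `O_i` and new ones `N_i`, both "at `(i, j)`". At stage `i₀` the middle row is
  `N_i (i < i₀) ∪ O_i (i > i₀)`, the rows to the left of `i₀` already carry the exchanged angles
  (`βStage`), and
  - **odd stage** (`i₀ + j` odd, `oddStage`): `⋆` isolated, the travelling rhombus
    `X_{i₀} = (B_{i₀}, O_{i₀}, T_{i₀}, N_{i₀})` (sides `e^{iβ_{j-1}}`, `e^{iβ_j}`, angle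
    `β_j - β_{j-1}` at `B_{i₀}` and `T_{i₀}`) contributes its primal diagonal `B_{i₀}T_{i₀}` with
    weight `p_{π-(β_j-β_{j-1})}`; the move is triangle `(B_{i₀}, O_{i₀+1}, T_{i₀})` → star at the
    new vertex `N_{i₀+1}`, born as `⋆`, after which `⋆` and the label `(i₀+1, j)` are exchanged
    (`swapMid`), giving the
  - **even stage** (`i₀ + j` even, `evenStage`): `⋆ = O_{i₀}` is the centre of the star
    `⋆N_{i₀}` (the primal diagonal of `X_{i₀}`, `p_{β_j-β_{j-1}}`), `⋆B_{i₀+1}`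
    (`p_{β_{j-1}-α_{i₀}}`), `⋆T_{i₀+1}` (`p_{π-(β_j-α_{i₀})}`), the label `(i₀, j)` now bearing
    `N_{i₀}`; the move is star → triangle `(N_{i₀}, B_{i₀+1}, T_{i₀+1})`, giving the odd stage
    `i₀ + 1`.
  The direction of the sweep is that of GM14: "`Σ_j` 'goes from left to right' when
  `β_j > β_{j-1}`" (the inserted rhombus `B + {0, e^{iβ_{j-1}}, e^{iβ_j}, e^{iβ_{j-1}} + e^{iβ_j}}`
  then sticks out to the left of `O_{-M} = B_{-M} + e^{iβ_{j-1}}`); "if `β_j < β_{j-1}`, we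
  construct `Σ_j` 'from right to left'" — the mirror image, not needed here.

## Results

* `evenStage_eq_afterMove` — stage `i₀` (even) **is** `afterMove` of stage `i₀ + 1` at the
  triangle `(N_{i₀}, B_{i₀+1}, T_{i₀+1})` with centre `⋆` (read backwards: the star → triangle
  move); `afterMove_oddStage` — `afterMove` of the odd stage `i₀` at `(B_{i₀}, O_{i₀+1}, T_{i₀})`,
  composed with `swapMid`, **is** the even stage `i₀ + 1`.
* `kappa_oddStage_succ_evenTri`, `kappa_oddStage_oddTri` (self-duality: the three dual angles add
  up to `2π` at every move), `oddStage_succ_triEdge_lt_one`, `oddStage_triEdge_lt_one`,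
  `oddStage_eq_zero_of_mem_none`, `evenTri_injective`, … — the side conditions of the tree's
  coupling lemmas, under the bounded-angles hypotheses `β_j - β_{j-1}, β_{j-1} - α_{i₀},
  β_j - α_{i₀} ∈ (0, π)`.
* `connEquiv_oddStage_succ_evenStage`, `connEquiv_oddStage_evenStage_succ` — consequently each
  step preserves the probability of every connective event of vertices other than `⋆` and the
  relabelled vertex (GM14 §5.2 "the star–triangle transformation maps `P_G` to `P_{G'}`" and
  preserves open connections; DKKMO eq. (17)).
* Boundary steps: `oddStage_neg` / `evenStage_neg` (insertion at `-M`: a new edge `B_{-M}T_{-M}`,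
  resp. `O_{-M}` renamed `⋆` plus a pendant `N_{-M}`), `update_oddStage_M` / `update_evenStage_M`
  (removal at `M` leaves `ExchangeData.exchanged = P_{α,σ_jβ}` on the strip).
* `canonicalWeight_map_gmLabel` — dictionary: along `(x, y) ↦ v_{x-y,x+y}` the canonical weights
  with `Θ i y = β_y - α_i` are the tree's `gmWeight α β` (`IsoradialSquareLatticeGM`, the weights of
  `isoradialPercolation (gmEmbedding α β)`) on the edges of the strip.

What is *not* here: positions/isoradial embedding of the stages (only weights matter for the
percolation process), the pathwise coupling and the transport of open paths (GM14 Figs. 5.3–5.5,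
§6), which are the next files of this line.

## References

* G. R. Grimmett, I. Manolescu, PTRF 159 (2014) 273–327, arXiv:1204.0505: §2.2 (2.3), §4.6
  (isoradial square lattices `G_{α,β}`), §5.1–5.3 (star–triangle transformation, track exchange).
* H. Duminil-Copin, K. K. Kozlowski, D. Krachun, I. Manolescu, M. Oulamara, arXiv:2012.11672v2,
  §2.6 (track-exchange operator).
-/

noncomputable section

namespace Literature.Probability.Percolation

open LatticeModels StarTriangle Real

namespace TrackExchange

/-! ### Grimmett–Manolescu's weight `p_θ` -/

/-- Grimmett–Manolescu's canonical weight `p_θ` of an edge subtending the angle `θ ∈ (0, π)` at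
the two circumcentres (PTRF 159 (2014) (2.3): `p_θ/(1-p_θ) = sin(⅓(π-θ))/sin(⅓θ)`), as a point
of `[0, 1]`; in the tree's half-angle convention this is `criticalWeightI ((π - θ)/2)`.
[cite: GrimmettManolescu2014Isoradial, §2.2 (2.3)] -/
def angleWeight (θ : ℝ) : unitInterval := criticalWeightI ((π - θ) / 2)

/-- `p_θ = sin(⅓(π-θ)) / (sin(⅓(π-θ)) + sin(⅓θ))` on `[0, π]`. [cite: GrimmettManolescu2014Isoradial, §2.2 (2.3)] -/
theorem coe_angleWeight {θ : ℝ} (hθ : θ ∈ Set.Icc 0 π) :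
    (angleWeight θ : ℝ) = Real.sin ((π - θ) / 3) / (Real.sin ((π - θ) / 3) + Real.sin (θ / 3)) := by
  unfold angleWeight
  rw [coe_criticalWeightI_holds ⟨by linarith [hθ.2], by linarith [hθ.1]⟩]
  unfold criticalWeight
  have e1 : 2 * ((π - θ) / 2) / 3 = (π - θ) / 3 := by ring
  have e2 : (π - 2 * ((π - θ) / 2)) / 3 = θ / 3 := by ring
  rw [e1, e2]

/-- `sin(θ/3) > 0` on `(0, π)`. [folklore] -/
theorem sin_third_pos {θ : ℝ} (hθ : θ ∈ Set.Ioo 0 π) : 0 < Real.sin (θ / 3) :=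
  Real.sin_pos_of_pos_of_lt_pi (by linarith [hθ.1]) (by linarith [hθ.2, Real.pi_pos])

/-- `sin((π-θ)/3) > 0` on `(0, π)`. [folklore] -/
theorem sin_third_sub_pos {θ : ℝ} (hθ : θ ∈ Set.Ioo 0 π) : 0 < Real.sin ((π - θ) / 3) :=
  Real.sin_pos_of_pos_of_lt_pi (by linarith [hθ.2]) (by linarith [hθ.1, Real.pi_pos])

/-- `0 < p_θ < 1` for `θ ∈ (0, π)` (GM14 (2.1): `p_e ∈ (0, 1)`). [cite: GrimmettManolescu2014Isoradial, §2.2] -/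
theorem coe_angleWeight_pos {θ : ℝ} (hθ : θ ∈ Set.Ioo 0 π) : 0 < (angleWeight θ : ℝ) := by
  rw [coe_angleWeight ⟨hθ.1.le, hθ.2.le⟩]
  exact div_pos (sin_third_sub_pos hθ) (add_pos (sin_third_sub_pos hθ) (sin_third_pos hθ))

/-- `p_θ < 1` for `θ ∈ (0, π)`. [cite: GrimmettManolescu2014Isoradial, §2.2] -/
theorem coe_angleWeight_lt_one {θ : ℝ} (hθ : θ ∈ Set.Ioo 0 π) : (angleWeight θ : ℝ) < 1 := by
  rw [coe_angleWeight ⟨hθ.1.le, hθ.2.le⟩, div_lt_one (add_pos (sin_third_sub_pos hθ) (sin_third_pos hθ))]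
  linarith [sin_third_pos hθ]

/-- **Duality of the weights** `p_θ + p_{π-θ} = 1` (GM14 §2.2: "Note that `p_θ + p_{π-θ} = 1`").
[cite: GrimmettManolescu2014Isoradial, §2.2] -/
theorem coe_angleWeight_add_coe_angleWeight_pi_sub {θ : ℝ} (hθ : θ ∈ Set.Ioo 0 π) :
    (angleWeight θ : ℝ) + angleWeight (π - θ) = 1 := by
  rw [coe_angleWeight ⟨hθ.1.le, hθ.2.le⟩, coe_angleWeight ⟨by linarith [hθ.2], by linarith [hθ.1]⟩,
    sub_sub_cancel, add_comm (Real.sin (θ / 3)), ← add_div,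
    div_self (add_pos (sin_third_sub_pos hθ) (sin_third_pos hθ)).ne']

/-- `1 - p_θ = p_{π-θ}` in `[0, 1]`. [cite: GrimmettManolescu2014Isoradial, §2.2] -/
theorem symm_angleWeight {θ : ℝ} (hθ : θ ∈ Set.Ioo 0 π) :
    unitInterval.symm (angleWeight θ) = angleWeight (π - θ) := by
  apply Subtype.ext
  rw [unitInterval.coe_symm_eq]
  linarith [coe_angleWeight_add_coe_angleWeight_pi_sub hθ]

/-- **Self-duality of a triangle of an isoradial graph in GM's convention**: if the three edges
of a triangle subtend angles `θ₀, θ₁, θ₂ ∈ (0, π)` at its circumcentre with `θ₀ + θ₁ + θ₂ = 2π`,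
then `κ_△(p_{θ₀}, p_{θ₁}, p_{θ₂}) = 0` (GM14 §5.2; the tree's `kappa_criticalWeight_eq_zero` in
the half-angle convention). [cite: GrimmettManolescu2014Isoradial, §5.2] -/
theorem kappa_angleWeight_eq_zero (θ : Fin 3 → ℝ) (hθ : ∀ k, θ k ∈ Set.Ioo 0 π)
    (hsum : θ 0 + θ 1 + θ 2 = 2 * π) :
    kappa (fun k => (angleWeight (θ k) : ℝ)) = 0 := by
  have h : (fun k => (angleWeight (θ k) : ℝ)) = fun k => criticalWeight ((π - θ k) / 2) := by
    funext k
    unfold angleWeight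
    rw [coe_criticalWeightI_holds ⟨by linarith [(hθ k).2], by linarith [(hθ k).1]⟩]
  rw [h]
  refine kappa_criticalWeight_eq_zero (fun k => (π - θ k) / 2) (fun k => ⟨?_, ?_⟩) ?_
  · linarith [(hθ k).2]
  · linarith [(hθ k).1]
  · linarith

/-! ### Vertices and the canonical weights of `G_{α,β}` in a strip -/

/-- Vertices of the strip during a track exchange: the points `(i, y)` of the diamond graph
(column `i`, height `y`; the vertex `v_{i,y}` of GM14 §4.6 is *primal* iff `i + y` is even) and
the travelling vertex `⋆ = none` (the centre of the star currently being slid along).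
[cite: GrimmettManolescu2014Isoradial, §4.6 and §5.3] -/
abbrev SV : Type := Option (ℤ × ℤ)

/-- `0` is the least element of `[0, 1]`. [folklore] -/
theorem unitInterval_zero_le (x : unitInterval) : (0 : unitInterval) ≤ x := Subtype.coe_le_coe.mp x.2.1

/-- The weight contributed by the rhombus `R_{i,y}` (tracks `t_i`, `s_y`; corners `(i,y)`,
`(i+1,y)`, `(i,y+1)`, `(i+1,y+1)`; angle `Θ i y` at the corners `(i,y)` and `(i+1,y+1)`, as for the
tree's `gmDartAngle`) to the ordered pair `(a, b)`: its primal diagonal is `(i,y)–(i+1,y+1)` (angle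
`π - Θ` at the two dual corners, weight `p_{π-Θ} = criticalWeightI (Θ/2)`, the tree's weight of a
horizontal edge of `G_{α,β}`) when `i + y` is even, and `(i+1,y)–(i,y+1)` (angle `Θ` at the dual
corners, weight `p_Θ = criticalWeightI ((π-Θ)/2)`, a vertical edge) when `i + y` is odd; only rhombi
with `-M ≤ i < M` are present (GM14 §4.6, §5.3: the strip `{v_{i,j} : -M ≤ i ≤ M}`). The unordered
weight is `dirWeight a b ⊔ dirWeight b a`. [cite: GrimmettManolescu2014Isoradial, §4.6] -/
def dirWeight (M : ℕ) (Θ : ℤ → ℤ → ℝ) : SV → SV → unitInterval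
  | some a, some b =>
    if b = (a.1 + 1, a.2 + 1) ∧ Even (a.1 + a.2) ∧ -(M : ℤ) ≤ a.1 ∧ a.1 < M then angleWeight (π - Θ a.1 a.2)
    else if b = (a.1 + 1, a.2 - 1) ∧ ¬ Even (a.1 + (a.2 - 1)) ∧ -(M : ℤ) ≤ a.1 ∧ a.1 < M then
      angleWeight (Θ a.1 (a.2 - 1))
    else 0
  | _, _ => 0

/-- The canonical weights of the isoradial square lattice with rhombus angles `Θ` in the strip of
half-width `M` (`⋆` isolated). For `Θ i y = β_y - α_i` this is GM14's `G_{α,β}` (§4.6: the rhombus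
of `t_i, s_j` "has internal angles `β_j - α_i` and `π - (β_j - α_i)`"), restricted to the strip,
with its canonical measure `P_{α,β} = prodBernoulli (canonicalWeight M Θ)`; see
`canonicalWeight_map_gmLabel` for the identification with the tree's `gmWeight α β`.
[cite: GrimmettManolescu2014Isoradial, §4.6] -/
def canonicalWeight (M : ℕ) (Θ : ℤ → ℤ → ℝ) : Sym2 SV → unitInterval :=
  Sym2.lift ⟨fun a b => max (dirWeight M Θ a b) (dirWeight M Θ b a), fun _ _ => max_comm _ _⟩

/-- Unfolding the canonical weight on a pair. [folklore] -/
@[simp] theorem canonicalWeight_mk (M : ℕ) (Θ : ℤ → ℤ → ℝ) (a b : SV) :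
    canonicalWeight M Θ s(a, b) = max (dirWeight M Θ a b) (dirWeight M Θ b a) := rfl

/-- `⋆` carries no canonical weight. [folklore] -/
@[simp] theorem dirWeight_none_left (M : ℕ) (Θ : ℤ → ℤ → ℝ) (b : SV) : dirWeight M Θ none b = 0 := by
  cases b <;> rfl

/-- `⋆` carries no canonical weight. [folklore] -/
@[simp] theorem dirWeight_none_right (M : ℕ) (Θ : ℤ → ℤ → ℝ) (a : SV) : dirWeight M Θ a none = 0 := by
  cases a <;> rfl

/-! ### The stages of the exchange of the tracks at levels `j - 1` and `j` -/

/-- Data of one track exchange `Σ_j` in the strip of half-width `M`: column angles `α`, row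
angles `β` (the track between heights `y` and `y + 1` has transverse angle `β y`), and the level
`j`; the tracks exchanged are those at levels `j - 1` (angle `β (j-1)`, "lower") and `j` (angle
`β j`, "upper"). [cite: GrimmettManolescu2014Isoradial, §5.3] -/
structure ExchangeData where
  /-- Half-width of the strip. -/
  M : ℕ
  /-- Transverse angles of the column tracks `t_i`. -/
  α : ℤ → ℝ
  /-- Transverse angles of the row tracks `s_y`. -/
  β : ℤ → ℝ
  /-- The upper of the two levels exchanged. -/
  j : ℤ

namespace ExchangeData

variable (D : ExchangeData)

/-- Lower track angle `β_{j-1}`. [folklore] -/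
def lo : ℝ := D.β (D.j - 1)

/-- Upper track angle `β_j`. [folklore] -/
def up : ℝ := D.β D.j

/-- Notation. [folklore] -/
@[simp] theorem β_j : D.β D.j = D.up := rfl
/-- Notation. [folklore] -/
@[simp] theorem β_j_sub_one : D.β (D.j - 1) = D.lo := rfl

/-- Row angles at stage `i₀`: to the left of column `i₀` the two tracks are already exchanged.
[cite: GrimmettManolescu2014Isoradial, §5.3] -/
def βStage (i₀ : ℤ) (i y : ℤ) : ℝ :=
  if y = D.j - 1 ∧ i < i₀ then D.up else if y = D.j ∧ i < i₀ then D.lo else D.β y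

/-- Rhombus angles at stage `i₀`. [cite: GrimmettManolescu2014Isoradial, §5.3] -/
def ΘStage (i₀ : ℤ) (i y : ℤ) : ℝ := D.βStage i₀ i y - D.α i

/-- The weights before the exchange: `G_{α,β}` in the strip. [cite: GrimmettManolescu2014Isoradial, §5.3] -/
def initial : Sym2 SV → unitInterval := canonicalWeight D.M fun i y => D.β y - D.α i

/-- The label of the middle-row vertex in column `i`. [folklore] -/
def mid (i : ℤ) : SV := some (i, D.j)
/-- The vertex `B_i = (i, j-1)` below the two tracks. [folklore] -/
def bot (i : ℤ) : SV := some (i, D.j - 1)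
/-- The vertex `T_i = (i, j+1)` above the two tracks. [folklore] -/
def top (i : ℤ) : SV := some (i, D.j + 1)

/-- **Odd stage `i₀`** (`i₀ + j` odd): the travelling rhombus `X_{i₀} = (B_{i₀}, O_{i₀}, T_{i₀},
N_{i₀})` (angle `β_j - β_{j-1}` at `B_{i₀}`, `T_{i₀}`, hence `π - (β_j - β_{j-1})` at its dual
corners `O_{i₀}`, `N_{i₀}`) has primal diagonal `B_{i₀}T_{i₀} = (i₀,j-1)–(i₀,j+1)` of weight
`p_{π-(β_j-β_{j-1})}`; everything else is canonical for the partially exchanged rows (to the left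
of column `i₀` the level `j - 1` carries `β_j` and the level `j` carries `β_{j-1}`), and `⋆` is
isolated. [cite: GrimmettManolescu2014Isoradial, §5.3] -/
def oddStage (i₀ : ℤ) : Sym2 SV → unitInterval :=
  Function.update (canonicalWeight D.M (D.ΘStage i₀)) s(D.bot i₀, D.top i₀)
    (if -(D.M : ℤ) ≤ i₀ ∧ i₀ ≤ D.M then angleWeight (π - (D.up - D.lo)) else 0)

/-- **Even stage `i₀`** (`i₀ + j` even): the old middle vertex `O_{i₀}` is the travelling vertex
`⋆`, the new middle vertex `N_{i₀}` carries the label `(i₀, j)`; `⋆` is the centre of the star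
with edges `⋆N_{i₀}` (the primal diagonal of `X_{i₀}`, dual corners `B_{i₀}`, `T_{i₀}` of angle
`β_j - β_{j-1}`, weight `p_{β_j-β_{j-1}}`), `⋆B_{i₀+1}` (the diagonal of the not yet exchanged
rhombus `R_{i₀,j-1}`, weight `p_{β_{j-1}-α_{i₀}}`) and `⋆T_{i₀+1}` (diagonal of `R_{i₀,j}`, weight
`p_{π-(β_j-α_{i₀})}`), and the label `(i₀, j)` has no edge towards column `i₀ + 1` (its edges to
`B_{i₀-1}`, `T_{i₀-1}` are the canonical ones of the exchanged rhombi `R_{i₀-1,j}`, `R_{i₀-1,j-1}`).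
[cite: GrimmettManolescu2014Isoradial, §5.3] -/
def evenStage (i₀ : ℤ) : Sym2 SV → unitInterval :=
  let inS : Prop := -(D.M : ℤ) ≤ i₀ ∧ i₀ ≤ D.M
  let inS' : Prop := -(D.M : ℤ) ≤ i₀ ∧ i₀ < D.M
  Function.update
    (Function.update
      (Function.update
        (Function.update
          (Function.update (canonicalWeight D.M (D.ΘStage i₀)) s(D.mid i₀, D.bot (i₀ + 1)) 0)
          s(D.mid i₀, D.top (i₀ + 1)) 0)
        s(none, D.mid i₀) (if inS then angleWeight (D.up - D.lo) else 0))
      s(none, D.bot (i₀ + 1)) (if inS' then angleWeight (D.lo - D.α i₀) else 0))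
    s(none, D.top (i₀ + 1)) (if inS' then angleWeight (π - (D.up - D.α i₀)) else 0)

/-- The weights at stage `i₀` of the sweep. [cite: GrimmettManolescu2014Isoradial, §5.3] -/
def stage (i₀ : ℤ) : Sym2 SV → unitInterval :=
  if Even (i₀ + D.j) then D.evenStage i₀ else D.oddStage i₀

/-- The triangle of the move at an even stage (star → triangle at `⋆ = O_{i₀}`): corners
`N_{i₀} = (i₀, j)`, `B_{i₀+1}`, `T_{i₀+1}`. [cite: GrimmettManolescu2014Isoradial, §5.3] -/
def evenTri (i₀ : ℤ) : Fin 3 → SV := ![D.mid i₀, D.bot (i₀ + 1), D.top (i₀ + 1)]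

/-- The triangle of the move at an odd stage (triangle → star at the new `⋆ = N_{i₀+1}`):
corners `B_{i₀}`, `O_{i₀+1} = (i₀+1, j)`, `T_{i₀}`. [cite: GrimmettManolescu2014Isoradial, §5.3] -/
def oddTri (i₀ : ℤ) : Fin 3 → SV := ![D.bot i₀, D.mid (i₀ + 1), D.top i₀]

/-- After the triangle → star move at an odd stage the new vertex `N_{i₀+1}` (born as `⋆`)
takes the label `(i₀+1, j)` and the old `O_{i₀+1}` becomes `⋆`. [cite: GrimmettManolescu2014Isoradial, §5.3] -/
def swapMid (i : ℤ) : SV ≃ SV := Equiv.swap none (D.mid i)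


/-! ### Elementary evaluations -/

section Eval

variable {D}

/-- Lattice labels are not `⋆`. [folklore] -/
@[simp] theorem mid_ne_none (i : ℤ) : D.mid i ≠ none := Option.some_ne_none _
/-- Lattice labels are not `⋆`. [folklore] -/
@[simp] theorem bot_ne_none (i : ℤ) : D.bot i ≠ none := Option.some_ne_none _
/-- Lattice labels are not `⋆`. [folklore] -/
@[simp] theorem top_ne_none (i : ℤ) : D.top i ≠ none := Option.some_ne_none _

/-- Labels in a row are determined by the column. [folklore] -/
@[simp] theorem mid_inj {i i' : ℤ} : D.mid i = D.mid i' ↔ i = i' := by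
  simp [ExchangeData.mid, Prod.ext_iff]
/-- Labels in a row are determined by the column. [folklore] -/
@[simp] theorem bot_inj {i i' : ℤ} : D.bot i = D.bot i' ↔ i = i' := by
  simp [ExchangeData.bot, Prod.ext_iff]
/-- Labels in a row are determined by the column. [folklore] -/
@[simp] theorem top_inj {i i' : ℤ} : D.top i = D.top i' ↔ i = i' := by
  simp [ExchangeData.top, Prod.ext_iff]
/-- Different rows have different labels. [folklore] -/
@[simp] theorem mid_ne_bot (i i' : ℤ) : D.mid i ≠ D.bot i' := by
  simp only [ExchangeData.mid, ExchangeData.bot, ne_eq, Option.some.injEq, Prod.ext_iff]; omega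
/-- Different rows have different labels. [folklore] -/
@[simp] theorem mid_ne_top (i i' : ℤ) : D.mid i ≠ D.top i' := by
  simp only [ExchangeData.mid, ExchangeData.top, ne_eq, Option.some.injEq, Prod.ext_iff]; omega
/-- Different rows have different labels. [folklore] -/
@[simp] theorem bot_ne_top (i i' : ℤ) : D.bot i ≠ D.top i' := by
  simp only [ExchangeData.bot, ExchangeData.top, ne_eq, Option.some.injEq, Prod.ext_iff]; omega
/-- Different rows have different labels. [folklore] -/
@[simp] theorem bot_ne_mid (i i' : ℤ) : D.bot i ≠ D.mid i' := (mid_ne_bot i' i).symm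
/-- Different rows have different labels. [folklore] -/
@[simp] theorem top_ne_mid (i i' : ℤ) : D.top i ≠ D.mid i' := (mid_ne_top i' i).symm
/-- Different rows have different labels. [folklore] -/
@[simp] theorem top_ne_bot (i i' : ℤ) : D.top i ≠ D.bot i' := (bot_ne_top i' i).symm
/-- Lattice labels are not `⋆`. [folklore] -/
@[simp] theorem none_ne_mid (i : ℤ) : (none : SV) ≠ D.mid i := (mid_ne_none i).symm
/-- Lattice labels are not `⋆`. [folklore] -/
@[simp] theorem none_ne_bot (i : ℤ) : (none : SV) ≠ D.bot i := (bot_ne_none i).symm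
/-- Lattice labels are not `⋆`. [folklore] -/
@[simp] theorem none_ne_top (i : ℤ) : (none : SV) ≠ D.top i := (top_ne_none i).symm

/-- The canonical weight vanishes on pairs containing `⋆`. [folklore] -/
theorem canonicalWeight_eq_zero_of_mem_none (M : ℕ) (Θ : ℤ → ℤ → ℝ) {e : Sym2 SV}
    (h : none ∈ e) : canonicalWeight M Θ e = 0 := by
  induction e using Sym2.ind with
  | _ a b =>
    rcases Sym2.mem_iff.1 h with rfl | rfl <;> simp

/-- `dirWeight` at `(a, b)` depends on `Θ` only through the rhombus of that ordered pair. [folklore] -/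
theorem dirWeight_congr {M : ℕ} {Θ Θ' : ℤ → ℤ → ℝ} {a b : ℤ × ℤ}
    (h1 : b = (a.1 + 1, a.2 + 1) → Even (a.1 + a.2) → Θ a.1 a.2 = Θ' a.1 a.2)
    (h2 : b = (a.1 + 1, a.2 - 1) → ¬ Even (a.1 + (a.2 - 1)) → Θ a.1 (a.2 - 1) = Θ' a.1 (a.2 - 1)) :
    dirWeight M Θ (some a) (some b) = dirWeight M Θ' (some a) (some b) := by
  simp only [dirWeight]
  split_ifs with hA hB
  · rw [h1 hA.1 hA.2.1]
  · rw [h2 hB.1 hB.2.1]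
  · rfl

/-- The canonical weight of the even-type diagonal `(i,y)–(i+1,y+1)`. [folklore] -/
theorem canonicalWeight_diag_up (M : ℕ) (Θ : ℤ → ℤ → ℝ) {i y : ℤ} (hpar : Even (i + y))
    (hi : -(M : ℤ) ≤ i) (hi' : i < M) :
    canonicalWeight M Θ s(some (i, y), some (i + 1, y + 1)) = angleWeight (π - Θ i y) := by
  rw [canonicalWeight_mk]
  have h1 : dirWeight M Θ (some (i, y)) (some (i + 1, y + 1)) = angleWeight (π - Θ i y) := by
    simp only [dirWeight]; rw [if_pos ⟨trivial, hpar, hi, hi'⟩]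
  have h2 : dirWeight M Θ (some (i + 1, y + 1)) (some (i, y)) = 0 := by
    simp only [dirWeight]
    rw [if_neg (by rintro ⟨h, -⟩; simp only [Prod.mk.injEq] at h; omega),
      if_neg (by rintro ⟨h, -⟩; simp only [Prod.mk.injEq] at h; omega)]
  rw [h1, h2, max_eq_left (unitInterval_zero_le _)]

/-- The canonical weight of the odd-type diagonal `(i,y+1)–(i+1,y)` of the rhombus `R_{i,y}`. [folklore] -/
theorem canonicalWeight_diag_down (M : ℕ) (Θ : ℤ → ℤ → ℝ) {i y : ℤ} (hpar : ¬ Even (i + y))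
    (hi : -(M : ℤ) ≤ i) (hi' : i < M) :
    canonicalWeight M Θ s(some (i, y + 1), some (i + 1, y)) = angleWeight (Θ i y) := by
  rw [canonicalWeight_mk]
  have h1 : dirWeight M Θ (some (i, y + 1)) (some (i + 1, y)) = angleWeight (Θ i y) := by
    simp only [dirWeight]
    rw [if_neg (by rintro ⟨h, -⟩; simp only [Prod.mk.injEq] at h; omega), add_sub_cancel_right,
      if_pos ⟨by simp, hpar, hi, hi'⟩]
  have h2 : dirWeight M Θ (some (i + 1, y)) (some (i, y + 1)) = 0 := by
    simp only [dirWeight]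
    rw [if_neg (by rintro ⟨h, -⟩; simp only [Prod.mk.injEq] at h; omega),
      if_neg (by rintro ⟨h, -⟩; simp only [Prod.mk.injEq] at h; omega)]
  rw [h1, h2, max_eq_left (unitInterval_zero_le _)]

/-- Pairs that are not a diagonal of a rhombus get weight `0`. [folklore] -/
theorem canonicalWeight_eq_zero_of_ne (M : ℕ) (Θ : ℤ → ℤ → ℝ) {a b : ℤ × ℤ}
    (h1 : b ≠ (a.1 + 1, a.2 + 1)) (h2 : b ≠ (a.1 + 1, a.2 - 1)) (h3 : b ≠ (a.1 - 1, a.2 - 1))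
    (h4 : b ≠ (a.1 - 1, a.2 + 1)) : canonicalWeight M Θ s(some a, some b) = 0 := by
  rw [canonicalWeight_mk]
  have ha : dirWeight M Θ (some a) (some b) = 0 := by
    simp only [dirWeight]; rw [if_neg (fun h => h1 h.1), if_neg (fun h => h2 h.1)]
  have hb : dirWeight M Θ (some b) (some a) = 0 := by
    simp only [dirWeight]
    rw [if_neg, if_neg]
    · rintro ⟨h, -⟩; apply h4; rw [h]; ext <;> simp
    · rintro ⟨h, -⟩; apply h3; rw [h]; ext <;> simp
  rw [ha, hb, max_self]

/-- In particular degenerate pairs get weight `0`. [folklore] -/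
theorem canonicalWeight_diag_self (M : ℕ) (Θ : ℤ → ℤ → ℝ) (a : ℤ × ℤ) :
    canonicalWeight M Θ s(some a, some a) = 0 :=
  canonicalWeight_eq_zero_of_ne M Θ (by simp [Prod.ext_iff]) (by simp [Prod.ext_iff])
    (by simp only [ne_eq, Prod.ext_iff]; omega) (by simp only [ne_eq, Prod.ext_iff]; omega)

/-- If the even-type diagonal of a rhombus is weighted, the rhombus is out of the strip or of the
wrong parity: then the weight is `0`. [folklore] -/
theorem canonicalWeight_diag_up_eq_zero (M : ℕ) (Θ : ℤ → ℤ → ℝ) {i y : ℤ}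
    (h : ¬ (Even (i + y) ∧ -(M : ℤ) ≤ i ∧ i < M)) :
    canonicalWeight M Θ s(some (i, y), some (i + 1, y + 1)) = 0 := by
  rw [canonicalWeight_mk]
  have h1 : dirWeight M Θ (some (i, y)) (some (i + 1, y + 1)) = 0 := by
    simp only [dirWeight]
    rw [if_neg (fun h' => h h'.2), if_neg (by rintro ⟨h, -⟩; simp only [Prod.mk.injEq] at h; omega)]
  have h2 : dirWeight M Θ (some (i + 1, y + 1)) (some (i, y)) = 0 := by
    simp only [dirWeight]
    rw [if_neg (by rintro ⟨h, -⟩; simp only [Prod.mk.injEq] at h; omega),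
      if_neg (by rintro ⟨h, -⟩; simp only [Prod.mk.injEq] at h; omega)]
  rw [h1, h2, max_self]

/-- Same for odd-type diagonals. [folklore] -/
theorem canonicalWeight_diag_down_eq_zero (M : ℕ) (Θ : ℤ → ℤ → ℝ) {i y : ℤ}
    (h : ¬ (¬ Even (i + y) ∧ -(M : ℤ) ≤ i ∧ i < M)) :
    canonicalWeight M Θ s(some (i, y + 1), some (i + 1, y)) = 0 := by
  rw [canonicalWeight_mk]
  have h1 : dirWeight M Θ (some (i, y + 1)) (some (i + 1, y)) = 0 := by
    simp only [dirWeight]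
    rw [if_neg (by rintro ⟨h, -⟩; simp only [Prod.mk.injEq] at h; omega), add_sub_cancel_right,
      if_neg (fun h' => h h'.2)]
  have h2 : dirWeight M Θ (some (i + 1, y)) (some (i, y + 1)) = 0 := by
    simp only [dirWeight]
    rw [if_neg (by rintro ⟨h, -⟩; simp only [Prod.mk.injEq] at h; omega),
      if_neg (by rintro ⟨h, -⟩; simp only [Prod.mk.injEq] at h; omega)]
  rw [h1, h2, max_self]

end Eval

/-! ### The moves between consecutive stages -/

section Moves

variable {D}

/-- At an odd stage `⋆` is isolated. [cite: GrimmettManolescu2014Isoradial, §5.3] -/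
theorem oddStage_eq_zero_of_mem_none (i₀ : ℤ) {e : Sym2 SV} (h : none ∈ e) : D.oddStage i₀ e = 0 := by
  unfold ExchangeData.oddStage
  rw [Function.update_of_ne]
  · exact canonicalWeight_eq_zero_of_mem_none _ _ h
  · rintro rfl
    simp [ExchangeData.bot, ExchangeData.top] at h

/-- The corners of the even-stage triangle are distinct. [folklore] -/
theorem evenTri_injective (i₀ : ℤ) : Function.Injective (D.evenTri i₀) := by
  intro a b h
  fin_cases a <;> fin_cases b <;> simp [ExchangeData.evenTri] at h ⊢

/-- The corners of the odd-stage triangle are distinct. [folklore] -/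
theorem oddTri_injective (i₀ : ℤ) : Function.Injective (D.oddTri i₀) := by
  intro a b h
  fin_cases a <;> fin_cases b <;> simp [ExchangeData.oddTri] at h ⊢

/-- Corner `0` of the even-stage triangle is `N_{i₀}`. [folklore] -/
@[simp] theorem evenTri_zero (i₀ : ℤ) : D.evenTri i₀ 0 = D.mid i₀ := rfl
/-- Corner `1` of the even-stage triangle is `B_{i₀+1}`. [folklore] -/
@[simp] theorem evenTri_one (i₀ : ℤ) : D.evenTri i₀ 1 = D.bot (i₀ + 1) := rfl
/-- Corner `2` of the even-stage triangle is `T_{i₀+1}`. [folklore] -/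
@[simp] theorem evenTri_two (i₀ : ℤ) : D.evenTri i₀ 2 = D.top (i₀ + 1) := rfl
/-- Corner `0` of the odd-stage triangle is `B_{i₀}`. [folklore] -/
@[simp] theorem oddTri_zero (i₀ : ℤ) : D.oddTri i₀ 0 = D.bot i₀ := rfl
/-- Corner `1` of the odd-stage triangle is `O_{i₀+1}`. [folklore] -/
@[simp] theorem oddTri_one (i₀ : ℤ) : D.oddTri i₀ 1 = D.mid (i₀ + 1) := rfl
/-- Corner `2` of the odd-stage triangle is `T_{i₀}`. [folklore] -/
@[simp] theorem oddTri_two (i₀ : ℤ) : D.oddTri i₀ 2 = D.top i₀ := rfl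

/-- The triangle edge opposite corner `0`. [folklore] -/
@[simp] theorem triEdge_zero' (v : Fin 3 → SV) : triEdge v 0 = s(v 1, v 2) := rfl
/-- The triangle edge opposite corner `1`. [folklore] -/
@[simp] theorem triEdge_one' (v : Fin 3 → SV) : triEdge v 1 = s(v 0, v 2) := rfl
/-- The triangle edge opposite corner `2`. [folklore] -/
@[simp] theorem triEdge_two' (v : Fin 3 → SV) : triEdge v 2 = s(v 0, v 1) := rfl

/-- The corners of the even-stage triangle are lattice labels. [folklore] -/
theorem evenTri_ne_none (i₀ : ℤ) (k : Fin 3) : D.evenTri i₀ k ≠ none := by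
  fin_cases k
  · exact mid_ne_none _
  · exact bot_ne_none _
  · exact top_ne_none _

/-- The corners of the odd-stage triangle are lattice labels. [folklore] -/
theorem oddTri_ne_none (i₀ : ℤ) (k : Fin 3) : D.oddTri i₀ k ≠ none := by
  fin_cases k
  · exact bot_ne_none _
  · exact mid_ne_none _
  · exact top_ne_none _

/-- At the odd stage `i₀ + 1` the travelling edge `B_{i₀+1}T_{i₀+1}` (opposite `N_{i₀}` in the
even-stage triangle) carries `p_{π-(β_j-β_{j-1})}`. [cite: GrimmettManolescu2014Isoradial, §5.3] -/
theorem oddStage_succ_triEdge_zero {i₀ : ℤ} (hi : -(D.M : ℤ) ≤ i₀) (hi' : i₀ < D.M) :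
    D.oddStage (i₀ + 1) (triEdge (D.evenTri i₀) 0) = angleWeight (π - (D.up - D.lo)) := by
  simp only [triEdge_zero', evenTri_one, evenTri_two, ExchangeData.oddStage]
  rw [Function.update_self, if_pos ⟨by omega, by omega⟩]

/-- At the odd stage `i₀ + 1` the edge `N_{i₀}T_{i₀+1}` (even diagonal of the rhombus `R_{i₀,j}`,
which already carries the lower angle `β_{j-1}`) has weight `p_{π-(β_{j-1}-α_{i₀})}`.
[cite: GrimmettManolescu2014Isoradial, §5.3] -/
theorem oddStage_succ_triEdge_one {i₀ : ℤ} (hpar : Even (i₀ + D.j)) (hi : -(D.M : ℤ) ≤ i₀)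
    (hi' : i₀ < D.M) :
    D.oddStage (i₀ + 1) (triEdge (D.evenTri i₀) 1) = angleWeight (π - (D.lo - D.α i₀)) := by
  simp only [triEdge_one', evenTri_zero, evenTri_two, ExchangeData.oddStage]
  rw [Function.update_of_ne (by simp)]
  simp only [canonicalWeight_mk, ExchangeData.mid, ExchangeData.top]
  have hj : ¬ (D.j = D.j - 1) := by omega
  have h1 : dirWeight D.M (D.ΘStage (i₀ + 1)) (some (i₀, D.j)) (some (i₀ + 1, D.j + 1)) =
      angleWeight (π - (D.lo - D.α i₀)) := by
    simp only [dirWeight]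
    rw [if_pos ⟨trivial, hpar, hi, hi'⟩]
    simp [ExchangeData.ΘStage, ExchangeData.βStage, hj]
  have h2 : dirWeight D.M (D.ΘStage (i₀ + 1)) (some (i₀ + 1, D.j + 1)) (some (i₀, D.j)) = 0 := by
    simp only [dirWeight]
    rw [if_neg (by rintro ⟨h, -⟩; simp only [Prod.mk.injEq] at h; omega),
      if_neg (by rintro ⟨h, -⟩; simp only [Prod.mk.injEq] at h; omega)]
  rw [h1, h2, max_eq_left (unitInterval_zero_le _)]

/-- At the odd stage `i₀ + 1` the edge `N_{i₀}B_{i₀+1}` (odd diagonal of the rhombus `R_{i₀,j-1}`,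
which already carries the upper angle `β_j`) has weight `p_{β_j-α_{i₀}}`.
[cite: GrimmettManolescu2014Isoradial, §5.3] -/
theorem oddStage_succ_triEdge_two {i₀ : ℤ} (hpar : Even (i₀ + D.j)) (hi : -(D.M : ℤ) ≤ i₀)
    (hi' : i₀ < D.M) :
    D.oddStage (i₀ + 1) (triEdge (D.evenTri i₀) 2) = angleWeight (D.up - D.α i₀) := by
  have hodd : ¬ Even (i₀ + (D.j - 1)) := by
    rw [Int.not_even_iff_odd]; obtain ⟨r, hr⟩ := hpar; exact ⟨r - 1, by omega⟩
  simp only [triEdge_two', evenTri_zero, evenTri_one, ExchangeData.oddStage]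
  rw [Function.update_of_ne (by simp)]
  simp only [canonicalWeight_mk, ExchangeData.mid, ExchangeData.bot]
  have h1 : dirWeight D.M (D.ΘStage (i₀ + 1)) (some (i₀, D.j)) (some (i₀ + 1, D.j - 1)) =
      angleWeight (D.up - D.α i₀) := by
    simp only [dirWeight]
    rw [if_neg (by rintro ⟨h, -⟩; simp only [Prod.mk.injEq] at h; omega),
      if_pos ⟨trivial, hodd, hi, hi'⟩]
    simp [ExchangeData.ΘStage, ExchangeData.βStage]
  have h2 : dirWeight D.M (D.ΘStage (i₀ + 1)) (some (i₀ + 1, D.j - 1)) (some (i₀, D.j)) = 0 := by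
    simp only [dirWeight]
    rw [if_neg (by rintro ⟨h, -⟩; simp only [Prod.mk.injEq] at h; omega),
      if_neg (by rintro ⟨h, -⟩; simp only [Prod.mk.injEq] at h; omega)]
  rw [h1, h2, max_eq_left (unitInterval_zero_le _)]


/-- Evaluation of the even-stage weights as a chain of cases. [folklore] -/
theorem evenStage_apply (i₀ : ℤ) (e : Sym2 SV) :
    D.evenStage i₀ e =
      if e = s(none, D.top (i₀ + 1)) then
        (if -(D.M : ℤ) ≤ i₀ ∧ i₀ < D.M then angleWeight (π - (D.up - D.α i₀)) else 0)
      else if e = s(none, D.bot (i₀ + 1)) then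
        (if -(D.M : ℤ) ≤ i₀ ∧ i₀ < D.M then angleWeight (D.lo - D.α i₀) else 0)
      else if e = s(none, D.mid i₀) then
        (if -(D.M : ℤ) ≤ i₀ ∧ i₀ ≤ D.M then angleWeight (D.up - D.lo) else 0)
      else if e = s(D.mid i₀, D.top (i₀ + 1)) then 0
      else if e = s(D.mid i₀, D.bot (i₀ + 1)) then 0
      else canonicalWeight D.M (D.ΘStage i₀) e := by
  simp only [ExchangeData.evenStage, Function.update_apply]

/-- Evaluation of the odd-stage weights. [folklore] -/
theorem oddStage_apply (i₀ : ℤ) (e : Sym2 SV) :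
    D.oddStage i₀ e =
      if e = s(D.bot i₀, D.top i₀) then
        (if -(D.M : ℤ) ≤ i₀ ∧ i₀ ≤ D.M then angleWeight (π - (D.up - D.lo)) else 0)
      else canonicalWeight D.M (D.ΘStage i₀) e := by
  simp only [ExchangeData.oddStage, Function.update_apply]

/-- Away from the two rhombi of column `i₀` in the exchanged rows, the canonical weights of the
stages `i₀` and `i₀ + 1` agree. [folklore] -/
theorem canonicalWeight_ΘStage_succ {i₀ : ℤ} (hpar : Even (i₀ + D.j)) {e : Sym2 SV}
    (h1 : e ≠ s(D.mid i₀, D.top (i₀ + 1))) (h2 : e ≠ s(D.mid i₀, D.bot (i₀ + 1))) :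
    canonicalWeight D.M (D.ΘStage i₀) e = canonicalWeight D.M (D.ΘStage (i₀ + 1)) e := by
  have hodd : ¬ Even (i₀ + (D.j - 1)) := by
    rw [Int.not_even_iff_odd]; obtain ⟨r, hr⟩ := hpar; exact ⟨r - 1, by omega⟩
  -- the two angle functions differ only at the rhombi `(i₀, j-1)` and `(i₀, j)`
  have hΘ : ∀ i y, (i, y) ≠ (i₀, D.j - 1) → (i, y) ≠ (i₀, D.j) →
      D.ΘStage i₀ i y = D.ΘStage (i₀ + 1) i y := by
    intro i y ha hb
    simp only [ExchangeData.ΘStage, ExchangeData.βStage, ne_eq, Prod.mk.injEq] at ha hb ⊢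
    by_cases hy1 : y = D.j - 1
    · have : i ≠ i₀ := fun h => ha ⟨h, hy1⟩
      have hiff : i < i₀ ↔ i < i₀ + 1 := by omega
      simp [hy1, hiff]
    · by_cases hy2 : y = D.j
      · have : i ≠ i₀ := fun h => hb ⟨h, hy2⟩
        have hiff : i < i₀ ↔ i < i₀ + 1 := by omega
        have hne : ¬ (D.j = D.j - 1) := by omega
        simp [hy2, hiff, hne]
      · simp [hy1, hy2]
  induction e using Sym2.ind with
  | _ a b =>
    cases a with
    | none => simp
    | some a =>
      cases b with
      | none => simp
      | some b =>
        simp only [canonicalWeight_mk]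
        have key : ∀ (c d : ℤ × ℤ), s((some c : SV), some d) ≠ s(D.mid i₀, D.top (i₀ + 1)) →
            s((some c : SV), some d) ≠ s(D.mid i₀, D.bot (i₀ + 1)) →
            dirWeight D.M (D.ΘStage i₀) (some c) (some d) =
              dirWeight D.M (D.ΘStage (i₀ + 1)) (some c) (some d) := by
          intro c d hct hcb
          refine dirWeight_congr (fun hd he => hΘ _ _ ?_ ?_) (fun hd he => hΘ _ _ ?_ ?_)
          · intro h
            have h' := Prod.ext_iff.1 h
            simp only at h'
            have : c.1 + c.2 = i₀ + (D.j - 1) := by omega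
            rw [this] at he
            exact hodd he
          · intro h
            have h' := Prod.ext_iff.1 h
            simp only at h'
            apply hct
            have hc : c = (i₀, D.j) := Prod.ext_iff.2 ⟨h'.1, h'.2⟩
            rw [hd, hc]
            rfl
          · intro h
            have h' := Prod.ext_iff.1 h
            simp only at h'
            apply hcb
            have hc : c = (i₀, D.j) := Prod.ext_iff.2 ⟨h'.1, by omega⟩
            rw [hd, hc]
            simp only [ExchangeData.mid, ExchangeData.bot]
          · intro h
            have h' := Prod.ext_iff.1 h
            simp only at h'
            have : c.1 + (c.2 - 1) = i₀ + D.j := by omega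
            rw [this] at he
            exact he hpar
        rw [key a b h1 h2, key b a (by rwa [Sym2.eq_swap]) (by rwa [Sym2.eq_swap])]

/-- **The move at an even stage.** For `i₀ + j` even, `-M ≤ i₀ < M` and angles in `(0, π)`, the
weights of the even stage `i₀` are those obtained from the odd stage `i₀ + 1` by the
triangle → star move of `StarTriangleMoves` at the triangle `(N_{i₀}, B_{i₀+1}, T_{i₀+1})` with
centre `⋆`; read backwards, the passage from stage `i₀` to stage `i₀ + 1` is the star → triangle
move at `⋆ = O_{i₀}` (GM14 §5.3: "The star–triangle transformation is applied within this hexagon,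
thereby moving the new rhombus to the right"). [cite: GrimmettManolescu2014Isoradial, §5.3] -/
theorem evenStage_eq_afterMove {i₀ : ℤ} (hpar : Even (i₀ + D.j)) (hi : -(D.M : ℤ) ≤ i₀)
    (hi' : i₀ < D.M) (hlu : D.up - D.lo ∈ Set.Ioo 0 π) (hlo : D.lo - D.α i₀ ∈ Set.Ioo 0 π)
    (hup : D.up - D.α i₀ ∈ Set.Ioo 0 π) :
    D.evenStage i₀ = afterMove (D.oddStage (i₀ + 1)) (D.evenTri i₀) none := by
  funext e
  unfold afterMove
  split_ifs with ht hs0 hs1 hs2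
  · -- the three triangle edges are closed at the even stage
    rw [evenStage_apply]
    rcases ht with rfl | rfl | rfl
    · -- `B T`
      simp only [triEdge_zero', evenTri_one, evenTri_two]
      rw [if_neg (by simp), if_neg (by simp), if_neg (by simp), if_neg (by simp), if_neg (by simp),
        canonicalWeight_mk]
      simp only [ExchangeData.bot, ExchangeData.top, dirWeight]
      rw [if_neg (by rintro ⟨h, -⟩; simp only [Prod.mk.injEq] at h; omega),
        if_neg (by rintro ⟨h, -⟩; simp only [Prod.mk.injEq] at h; omega),
        if_neg (by rintro ⟨h, -⟩; simp only [Prod.mk.injEq] at h; omega),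
        if_neg (by rintro ⟨h, -⟩; simp only [Prod.mk.injEq] at h; omega), max_self]
    · -- `N T`
      simp
    · -- `N B`
      simp
  · -- `⋆ N_{i₀}`
    subst hs0
    rw [oddStage_succ_triEdge_zero hi hi',
      symm_angleWeight (θ := π - (D.up - D.lo)) ⟨by linarith [hlu.2], by linarith [hlu.1]⟩,
      sub_sub_cancel, evenStage_apply]
    simp [starEdge, hi, hi'.le]
  · -- `⋆ B_{i₀+1}`
    subst hs1
    rw [oddStage_succ_triEdge_one hpar hi hi',
      symm_angleWeight (θ := π - (D.lo - D.α i₀)) ⟨by linarith [hlo.2], by linarith [hlo.1]⟩,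
      sub_sub_cancel, evenStage_apply]
    simp [starEdge, hi, hi']
  · -- `⋆ T_{i₀+1}`
    subst hs2
    rw [oddStage_succ_triEdge_two hpar hi hi', symm_angleWeight hup, evenStage_apply]
    simp [starEdge, hi, hi']
  · -- generic edges
    simp only [not_or, triEdge_zero', triEdge_one', triEdge_two', evenTri_zero, evenTri_one,
      evenTri_two, starEdge] at ht hs0 hs1 hs2
    rw [evenStage_apply, if_neg hs2, if_neg hs1, if_neg hs0, if_neg ht.2.1, if_neg ht.2.2,
      oddStage_apply, if_neg ht.1]
    exact canonicalWeight_ΘStage_succ hpar ht.2.1 ht.2.2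


/-! #### The move at an odd stage -/

/-- At the odd stage `i₀` the edge `O_{i₀+1}T_{i₀}` (odd diagonal of the rhombus `R_{i₀,j}`, still
carrying the upper angle `β_j`) has weight `p_{β_j-α_{i₀}}`. [cite: GrimmettManolescu2014Isoradial, §5.3] -/
theorem oddStage_triEdge_zero {i₀ : ℤ} (hpar : ¬ Even (i₀ + D.j)) (hi : -(D.M : ℤ) ≤ i₀)
    (hi' : i₀ < D.M) :
    D.oddStage i₀ (triEdge (D.oddTri i₀) 0) = angleWeight (D.up - D.α i₀) := by
  simp only [triEdge_zero', oddTri_one, oddTri_two]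
  rw [oddStage_apply, if_neg (by simp), ExchangeData.mid, ExchangeData.top, Sym2.eq_swap,
    canonicalWeight_diag_down D.M _ hpar hi hi']
  simp [ExchangeData.ΘStage, ExchangeData.βStage]

/-- At the odd stage `i₀` the travelling edge `B_{i₀}T_{i₀}` has weight `p_{π-(β_j-β_{j-1})}`.
[cite: GrimmettManolescu2014Isoradial, §5.3] -/
theorem oddStage_triEdge_one {i₀ : ℤ} (hi : -(D.M : ℤ) ≤ i₀) (hi' : i₀ < D.M) :
    D.oddStage i₀ (triEdge (D.oddTri i₀) 1) = angleWeight (π - (D.up - D.lo)) := by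
  simp only [triEdge_one', oddTri_zero, oddTri_two]
  rw [oddStage_apply, if_pos rfl, if_pos ⟨hi, hi'.le⟩]

/-- At the odd stage `i₀` the edge `B_{i₀}O_{i₀+1}` (even diagonal of the rhombus `R_{i₀,j-1}`,
still carrying the lower angle `β_{j-1}`) has weight `p_{π-(β_{j-1}-α_{i₀})}`.
[cite: GrimmettManolescu2014Isoradial, §5.3] -/
theorem oddStage_triEdge_two {i₀ : ℤ} (hpar : ¬ Even (i₀ + D.j)) (hi : -(D.M : ℤ) ≤ i₀)
    (hi' : i₀ < D.M) :
    D.oddStage i₀ (triEdge (D.oddTri i₀) 2) = angleWeight (π - (D.lo - D.α i₀)) := by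
  have hev : Even (i₀ + (D.j - 1)) := by
    rcases Int.even_or_odd (i₀ + D.j) with h | ⟨r, hr⟩
    · exact absurd h hpar
    · exact ⟨r, by omega⟩
  simp only [triEdge_two', oddTri_zero, oddTri_one]
  rw [oddStage_apply, if_neg (by simp), ExchangeData.mid, ExchangeData.bot,
    show ((i₀ + 1, D.j) : ℤ × ℤ) = (i₀ + 1, D.j - 1 + 1) by rw [sub_add_cancel],
    canonicalWeight_diag_up D.M _ hev hi hi']
  have hj : ¬ (D.j - 1 = D.j) := by omega
  simp [ExchangeData.ΘStage, ExchangeData.βStage, hj]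

/-- Away from the two rhombi of column `i₀` in the exchanged rows, the canonical weights of the
stages `i₀` and `i₀ + 1` agree (odd parity). [folklore] -/
theorem canonicalWeight_ΘStage_succ_odd {i₀ : ℤ} (hpar : ¬ Even (i₀ + D.j)) {e : Sym2 SV}
    (h1 : e ≠ s(D.bot i₀, D.mid (i₀ + 1))) (h2 : e ≠ s(D.mid (i₀ + 1), D.top i₀)) :
    canonicalWeight D.M (D.ΘStage i₀) e = canonicalWeight D.M (D.ΘStage (i₀ + 1)) e := by
  have hev : Even (i₀ + (D.j - 1)) := by
    rcases Int.even_or_odd (i₀ + D.j) with h | ⟨r, hr⟩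
    · exact absurd h hpar
    · exact ⟨r, by omega⟩
  have hΘ : ∀ i y, (i, y) ≠ (i₀, D.j - 1) → (i, y) ≠ (i₀, D.j) →
      D.ΘStage i₀ i y = D.ΘStage (i₀ + 1) i y := by
    intro i y ha hb
    simp only [ExchangeData.ΘStage, ExchangeData.βStage, ne_eq, Prod.mk.injEq] at ha hb ⊢
    by_cases hy1 : y = D.j - 1
    · have : i ≠ i₀ := fun h => ha ⟨h, hy1⟩
      have hiff : i < i₀ ↔ i < i₀ + 1 := by omega
      simp [hy1, hiff]
    · by_cases hy2 : y = D.j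
      · have : i ≠ i₀ := fun h => hb ⟨h, hy2⟩
        have hiff : i < i₀ ↔ i < i₀ + 1 := by omega
        have hne : ¬ (D.j = D.j - 1) := by omega
        simp [hy2, hiff, hne]
      · simp [hy1, hy2]
  induction e using Sym2.ind with
  | _ a b =>
    cases a with
    | none => simp
    | some a =>
      cases b with
      | none => simp
      | some b =>
        simp only [canonicalWeight_mk]
        have key : ∀ (c d : ℤ × ℤ), s((some c : SV), some d) ≠ s(D.bot i₀, D.mid (i₀ + 1)) →
            s((some c : SV), some d) ≠ s(D.mid (i₀ + 1), D.top i₀) →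
            dirWeight D.M (D.ΘStage i₀) (some c) (some d) =
              dirWeight D.M (D.ΘStage (i₀ + 1)) (some c) (some d) := by
          intro c d hcb hct
          refine dirWeight_congr (fun hd he => hΘ _ _ ?_ ?_) (fun hd he => hΘ _ _ ?_ ?_)
          · intro h
            have h' := Prod.ext_iff.1 h
            simp only at h'
            apply hcb
            have hc : c = (i₀, D.j - 1) := Prod.ext_iff.2 ⟨h'.1, h'.2⟩
            rw [hd, hc]
            simp only [ExchangeData.mid, ExchangeData.bot, sub_add_cancel]
          · intro h
            have h' := Prod.ext_iff.1 h
            simp only at h'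
            have : c.1 + c.2 = i₀ + D.j := by omega
            rw [this] at he
            exact hpar he
          · intro h
            have h' := Prod.ext_iff.1 h
            simp only at h'
            have : c.1 + (c.2 - 1) = i₀ + (D.j - 1) := by omega
            rw [this] at he
            exact he hev
          · intro h
            have h' := Prod.ext_iff.1 h
            simp only at h'
            apply hct
            have hc : c = (i₀, D.j + 1) := Prod.ext_iff.2 ⟨h'.1, by omega⟩
            rw [Sym2.eq_swap, hd, hc]
            simp only [ExchangeData.mid, ExchangeData.top, add_sub_cancel_right]
        rw [key a b h1 h2, key b a (by rwa [Sym2.eq_swap]) (by rwa [Sym2.eq_swap])]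

/-- The relabelling sends `⋆` to `(i, j)`. [folklore] -/
@[simp] theorem swapMid_none (i : ℤ) : D.swapMid i none = D.mid i := Equiv.swap_apply_left _ _
/-- The relabelling sends `(i, j)` to `⋆`. [folklore] -/
@[simp] theorem swapMid_mid (i : ℤ) : D.swapMid i (D.mid i) = none := Equiv.swap_apply_right _ _
/-- The relabelling fixes all other vertices. [folklore] -/
theorem swapMid_of_ne {i : ℤ} {x : SV} (h1 : x ≠ none) (h2 : x ≠ D.mid i) : D.swapMid i x = x :=
  Equiv.swap_apply_of_ne_of_ne h1 h2
/-- The relabelling fixes the lower row. [folklore] -/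
@[simp] theorem swapMid_bot (i i' : ℤ) : D.swapMid i (D.bot i') = D.bot i' := swapMid_of_ne (by simp) (by simp)
/-- The relabelling fixes the upper row. [folklore] -/
@[simp] theorem swapMid_top (i i' : ℤ) : D.swapMid i (D.top i') = D.top i' := swapMid_of_ne (by simp) (by simp)

/-! Deciding equalities of unordered pairs of strip vertices. -/

/-- Deciding equalities of pairs of strip vertices. [folklore] -/
@[simp] theorem sym2_none_some_eq_none_some {b d : ℤ × ℤ} :
    s((none : SV), some b) = s(none, some d) ↔ b = d := by
  simp

/-- Deciding equalities of pairs of strip vertices. [folklore] -/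
@[simp] theorem sym2_none_some_ne_some_some (b c d : ℤ × ℤ) :
    s((none : SV), some b) ≠ s(some c, some d) := by
  simp

/-- Deciding equalities of pairs of strip vertices. [folklore] -/
@[simp] theorem sym2_some_some_ne_none_some (a b d : ℤ × ℤ) :
    s((some a : SV), some b) ≠ s(none, some d) := by
  simp

/-- Deciding equalities of pairs of strip vertices. [folklore] -/
@[simp] theorem sym2_some_none_ne_none_some (a d : ℤ × ℤ) :
    s((some a : SV), none) ≠ s(none, some d) ↔ a ≠ d := by
  simp

/-- Deciding equalities of pairs of strip vertices. [folklore] -/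
theorem sym2_some_some_eq_iff {a b c d : ℤ × ℤ} :
    s((some a : SV), some b) = s(some c, some d) ↔ (a = c ∧ b = d) ∨ (a = d ∧ b = c) := by
  simp

/-! Evaluations of the even stage `i₀ + 1` used for the odd move. -/

section EvenSucc

variable {i : ℤ}

/-- At an even stage `i`, `⋆` is joined only to `N_i`, `B_{i+1}`, `T_{i+1}`. [cite: GrimmettManolescu2014Isoradial, §5.3] -/
theorem evenStage_succ_none_some {y : ℤ × ℤ} (hy1 : y ≠ (i + 1, D.j + 1))
    (hy2 : y ≠ (i + 1, D.j - 1)) (hy3 : y ≠ (i, D.j)) :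
    D.evenStage i s(none, some y) = 0 := by
  rw [evenStage_apply, ExchangeData.top, ExchangeData.bot, ExchangeData.mid, if_neg (by simpa using hy1),
    if_neg (by simpa using hy2), if_neg (by simpa using hy3), if_neg (by simp), if_neg (by simp)]
  exact canonicalWeight_eq_zero_of_mem_none _ _ (Sym2.mem_mk_left _ _)

/-- At an even stage `i`, the new middle vertex `N_i = (i, j)` has its canonical edges except towards column `i + 1`. [cite: GrimmettManolescu2014Isoradial, §5.3] -/
theorem evenStage_succ_mid_some {y : ℤ × ℤ} (hy1 : y ≠ (i + 1, D.j + 1))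
    (hy2 : y ≠ (i + 1, D.j - 1)) :
    D.evenStage i s(D.mid i, some y) =
      canonicalWeight D.M (D.ΘStage i) s(some (i, D.j), some y) := by
  rw [evenStage_apply, ExchangeData.top, ExchangeData.bot, ExchangeData.mid, if_neg (by simp),
    if_neg (by simp), if_neg (by simp), if_neg, if_neg]
  · intro h
    rcases sym2_some_some_eq_iff.1 h with ⟨-, h'⟩ | ⟨h', -⟩
    · exact hy2 h'
    · simp only [Prod.mk.injEq] at h'; omega
  · intro h
    rcases sym2_some_some_eq_iff.1 h with ⟨-, h'⟩ | ⟨h', -⟩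
    · exact hy1 h'
    · simp only [Prod.mk.injEq] at h'; omega

/-- Degenerate pair. [folklore] -/
theorem evenStage_succ_none_none : D.evenStage i s(none, none) = 0 := by
  rw [evenStage_apply, if_neg (by simp), if_neg (by simp), if_neg (by simp), if_neg (by simp),
    if_neg (by simp)]
  exact canonicalWeight_eq_zero_of_mem_none _ _ (Sym2.mem_mk_left _ _)

/-- Degenerate pair. [folklore] -/
theorem evenStage_succ_mid_mid : D.evenStage i s(D.mid i, D.mid i) = 0 := by
  rw [evenStage_apply, ExchangeData.top, ExchangeData.bot, ExchangeData.mid, if_neg (by simp),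
    if_neg (by simp), if_neg (by simp), if_neg, if_neg, canonicalWeight_diag_self]
  · intro h
    rcases sym2_some_some_eq_iff.1 h with ⟨-, h'⟩ | ⟨h', -⟩ <;>
      simp only [Prod.mk.injEq] at h' <;> omega
  · intro h
    rcases sym2_some_some_eq_iff.1 h with ⟨-, h'⟩ | ⟨h', -⟩ <;>
      simp only [Prod.mk.injEq] at h' <;> omega

/-- The travelling edge `⋆N_i` has weight `p_{β_j-β_{j-1}}`. [cite: GrimmettManolescu2014Isoradial, §5.3] -/
theorem evenStage_succ_none_mid (hi : -(D.M : ℤ) ≤ i) (hi' : i ≤ D.M) :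
    D.evenStage i s(none, D.mid i) = angleWeight (D.up - D.lo) := by
  rw [evenStage_apply, if_neg (by simp), if_neg (by simp), if_pos rfl, if_pos ⟨hi, hi'⟩]

/-- The edge `⋆T_{i+1}` has weight `p_{π-(β_j-α_i)}` (inside the strip). [cite: GrimmettManolescu2014Isoradial, §5.3] -/
theorem evenStage_succ_none_top : D.evenStage i s(none, D.top (i + 1)) =
    if -(D.M : ℤ) ≤ i ∧ i < D.M then angleWeight (π - (D.up - D.α i)) else 0 := by
  rw [evenStage_apply, if_pos rfl]

/-- The edge `⋆B_{i+1}` has weight `p_{β_{j-1}-α_i}` (inside the strip). [cite: GrimmettManolescu2014Isoradial, §5.3] -/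
theorem evenStage_succ_none_bot : D.evenStage i s(none, D.bot (i + 1)) =
    if -(D.M : ℤ) ≤ i ∧ i < D.M then angleWeight (D.lo - D.α i) else 0 := by
  rw [evenStage_apply, if_neg (by simp), if_pos rfl]

/-- `N_i` has no edge to `T_{i+1}` yet. [cite: GrimmettManolescu2014Isoradial, §5.3] -/
theorem evenStage_succ_mid_top : D.evenStage i s(D.mid i, D.top (i + 1)) = 0 := by
  rw [evenStage_apply, if_neg (by simp), if_neg (by simp), if_neg (by simp), if_pos rfl]

/-- `N_i` has no edge to `B_{i+1}` yet. [cite: GrimmettManolescu2014Isoradial, §5.3] -/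
theorem evenStage_succ_mid_bot : D.evenStage i s(D.mid i, D.bot (i + 1)) = 0 := by
  rw [evenStage_apply, if_neg (by simp), if_neg (by simp), if_neg (by simp), if_neg (by simp), if_pos rfl]

/-- Away from `⋆` and `(i, j)` the even stage is canonical. [cite: GrimmettManolescu2014Isoradial, §5.3] -/
theorem evenStage_succ_some_some {x y : ℤ × ℤ} (hx : x ≠ (i, D.j)) (hy : y ≠ (i, D.j)) :
    D.evenStage i s(some x, some y) = canonicalWeight D.M (D.ΘStage i) s(some x, some y) := by
  rw [evenStage_apply, ExchangeData.top, ExchangeData.bot, ExchangeData.mid, if_neg (by simp),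
    if_neg (by simp), if_neg (by simp), if_neg, if_neg]
  · intro h
    rcases sym2_some_some_eq_iff.1 h with ⟨h', -⟩ | ⟨-, h'⟩
    · exact hx h'
    · exact hy h'
  · intro h
    rcases sym2_some_some_eq_iff.1 h with ⟨h', -⟩ | ⟨-, h'⟩
    · exact hx h'
    · exact hy h'

end EvenSucc

/-! Evaluations of the canonical part of the odd stage `i₀` at the old middle vertex `O_{i₀+1}`. -/

section OddCanon

variable {i₀ : ℤ}

/-- The old middle vertex `O_{i₀+1}` is joined to `T_{i₀+2}` with weight `p_{π-(β_j-α_{i₀+1})}`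
at the odd stage `i₀` (inside the strip). [cite: GrimmettManolescu2014Isoradial, §5.3] -/
theorem canonicalWeight_ΘStage_mid_top (hpar : ¬ Even (i₀ + D.j)) :
    canonicalWeight D.M (D.ΘStage i₀) s(some (i₀ + 1, D.j), some (i₀ + 1 + 1, D.j + 1)) =
      if -(D.M : ℤ) ≤ i₀ + 1 ∧ i₀ + 1 < D.M then angleWeight (π - (D.up - D.α (i₀ + 1))) else 0 := by
  have hev' : Even (i₀ + 1 + D.j) := by
    rcases Int.even_or_odd (i₀ + D.j) with h | ⟨r, hr⟩
    · exact absurd h hpar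
    · exact ⟨r + 1, by omega⟩
  split_ifs with hs
  · rw [canonicalWeight_diag_up D.M _ hev' hs.1 hs.2]
    simp [ExchangeData.ΘStage, ExchangeData.βStage]
  · exact canonicalWeight_diag_up_eq_zero D.M _ (fun h => hs h.2)

/-- The old middle vertex `O_{i₀+1}` is joined to `B_{i₀+2}` with weight `p_{β_{j-1}-α_{i₀+1}}` at
the odd stage `i₀` (inside the strip). [cite: GrimmettManolescu2014Isoradial, §5.3] -/
theorem canonicalWeight_ΘStage_mid_bot (hpar : ¬ Even (i₀ + D.j)) :
    canonicalWeight D.M (D.ΘStage i₀) s(some (i₀ + 1, D.j), some (i₀ + 1 + 1, D.j - 1)) =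
      if -(D.M : ℤ) ≤ i₀ + 1 ∧ i₀ + 1 < D.M then angleWeight (D.lo - D.α (i₀ + 1)) else 0 := by
  have hodd' : ¬ Even (i₀ + 1 + (D.j - 1)) := by
    rw [show i₀ + 1 + (D.j - 1) = i₀ + D.j by ring]; exact hpar
  rw [show ((i₀ + 1, D.j) : ℤ × ℤ) = (i₀ + 1, D.j - 1 + 1) by rw [sub_add_cancel]]
  split_ifs with hs
  · rw [canonicalWeight_diag_down D.M _ hodd' hs.1 hs.2]
    have hj : ¬ (D.j - 1 = D.j) := by omega
    simp [ExchangeData.ΘStage, ExchangeData.βStage, hj]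
  · exact canonicalWeight_diag_down_eq_zero D.M _ (fun h => hs h.2)

/-- The middle vertex of column `i₀ + 1` has no other canonical partners. [folklore] -/
theorem canonicalWeight_ΘStage_mid_of_ne (Θ : ℤ → ℤ → ℝ) {y : ℤ × ℤ}
    (hy1 : y ≠ (i₀ + 1 + 1, D.j + 1)) (hy2 : y ≠ (i₀ + 1 + 1, D.j - 1)) (hy3 : y ≠ (i₀, D.j - 1))
    (hy4 : y ≠ (i₀, D.j + 1)) :
    canonicalWeight D.M Θ s(some (i₀ + 1, D.j), some y) = 0 :=
  canonicalWeight_eq_zero_of_ne _ _ (by simpa using hy1) (by simpa using hy2)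
    (by simpa using hy3) (by simpa using hy4)

end OddCanon

/-- **The move at an odd stage.** For `i₀ + j` odd, `-M ≤ i₀ < M` and angles in `(0, π)`: applying
the triangle → star move of `StarTriangleMoves` to the odd stage `i₀` at the triangle
`(B_{i₀}, O_{i₀+1}, T_{i₀})`, with the new vertex born as `⋆`, and then exchanging the names of
`⋆` and `(i₀+1, j)` (so that the new middle vertex `N_{i₀+1}` carries the lattice label and the old
`O_{i₀+1}` becomes the travelling vertex) gives exactly the even stage `i₀ + 1`.
[cite: GrimmettManolescu2014Isoradial, §5.3] -/
theorem afterMove_oddStage {i₀ : ℤ} (hpar : ¬ Even (i₀ + D.j)) (hi : -(D.M : ℤ) ≤ i₀)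
    (hi' : i₀ < D.M) (hlu : D.up - D.lo ∈ Set.Ioo 0 π) (hlo : D.lo - D.α i₀ ∈ Set.Ioo 0 π)
    (hup : D.up - D.α i₀ ∈ Set.Ioo 0 π) (e : Sym2 SV) :
    afterMove (D.oddStage i₀) (D.oddTri i₀) none e =
      D.evenStage (i₀ + 1) (Sym2.map (D.swapMid (i₀ + 1)) e) := by
  have hev : Even (i₀ + (D.j - 1)) := by
    rcases Int.even_or_odd (i₀ + D.j) with h | ⟨r, hr⟩
    · exact absurd h hpar
    · exact ⟨r, by omega⟩
  unfold afterMove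
  split_ifs with ht hs0 hs1 hs2
  · -- triangle edges: closed after the move; their `σ`-images are unweighted at the even stage
    rcases ht with rfl | rfl | rfl
    · simp only [triEdge_zero', oddTri_one, oddTri_two, Sym2.map_mk, swapMid_mid, swapMid_top]
      rw [ExchangeData.top, evenStage_succ_none_some (by simp only [ne_eq, Prod.mk.injEq]; omega)
        (by simp only [ne_eq, Prod.mk.injEq]; omega) (by simp only [ne_eq, Prod.mk.injEq]; omega)]
    · simp only [triEdge_one', oddTri_zero, oddTri_two, Sym2.map_mk, swapMid_bot, swapMid_top]
      rw [ExchangeData.bot, ExchangeData.top, evenStage_succ_some_some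
        (by simp only [ne_eq, Prod.mk.injEq]; omega) (by simp only [ne_eq, Prod.mk.injEq]; omega)]
      exact (canonicalWeight_eq_zero_of_ne _ _ (by simp only [ne_eq, Prod.ext_iff]; omega)
        (by simp only [ne_eq, Prod.ext_iff]; omega) (by simp only [ne_eq, Prod.ext_iff]; omega)
        (by simp only [ne_eq, Prod.ext_iff]; omega)).symm
    · simp only [triEdge_two', oddTri_zero, oddTri_one, Sym2.map_mk, swapMid_mid, swapMid_bot]
      rw [ExchangeData.bot, Sym2.eq_swap, evenStage_succ_none_some
        (by simp only [ne_eq, Prod.mk.injEq]; omega) (by simp only [ne_eq, Prod.mk.injEq]; omega)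
        (by simp only [ne_eq, Prod.mk.injEq]; omega)]
  · -- `⋆ B_{i₀}`
    subst hs0
    simp only [starEdge, oddTri_zero, Sym2.map_mk, swapMid_none, swapMid_bot]
    rw [oddStage_triEdge_zero hpar hi hi', symm_angleWeight hup, ExchangeData.bot,
      evenStage_succ_mid_some (by simp only [ne_eq, Prod.ext_iff]; omega)
        (by simp only [ne_eq, Prod.ext_iff]; omega),
      Sym2.eq_swap, show ((i₀ + 1, D.j) : ℤ × ℤ) = (i₀ + 1, D.j - 1 + 1) by rw [sub_add_cancel],
      canonicalWeight_diag_up D.M _ hev hi hi']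
    simp [ExchangeData.ΘStage, ExchangeData.βStage]
  · -- `⋆ O_{i₀+1}`: the travelling rhombus
    subst hs1
    simp only [starEdge, oddTri_one, Sym2.map_mk, swapMid_none, swapMid_mid]
    rw [oddStage_triEdge_one hi hi',
      symm_angleWeight (θ := π - (D.up - D.lo)) ⟨by linarith [hlu.2], by linarith [hlu.1]⟩,
      sub_sub_cancel, Sym2.eq_swap, evenStage_succ_none_mid (by omega) (by omega)]
  · -- `⋆ T_{i₀}`
    subst hs2
    simp only [starEdge, oddTri_two, Sym2.map_mk, swapMid_none, swapMid_top]
    rw [oddStage_triEdge_two hpar hi hi',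
      symm_angleWeight (θ := π - (D.lo - D.α i₀)) ⟨by linarith [hlo.2], by linarith [hlo.1]⟩,
      sub_sub_cancel, ExchangeData.top,
      evenStage_succ_mid_some (by simp only [ne_eq, Prod.ext_iff]; omega)
        (by simp only [ne_eq, Prod.ext_iff]; omega),
      Sym2.eq_swap, canonicalWeight_diag_down D.M _ hpar hi hi']
    have hj : ¬ (D.j = D.j - 1) := by omega
    simp [ExchangeData.ΘStage, ExchangeData.βStage, hj]
  · -- generic edges
    simp only [not_or, triEdge_zero', triEdge_one', triEdge_two', oddTri_zero, oddTri_one,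
      oddTri_two, starEdge] at ht hs0 hs1 hs2
    rw [oddStage_apply, if_neg ht.2.1]
    -- reduce to ordered pairs with the special endpoint, if any, in front
    suffices key : ∀ a b : SV, s(a, b) ≠ s(D.mid (i₀ + 1), D.top i₀) →
        s(a, b) ≠ s(D.bot i₀, D.mid (i₀ + 1)) → s(a, b) ≠ s(none, D.bot i₀) →
        s(a, b) ≠ s(none, D.mid (i₀ + 1)) → s(a, b) ≠ s(none, D.top i₀) →
        (a = none ∨ a = D.mid (i₀ + 1) ∨
          (a ≠ none ∧ a ≠ D.mid (i₀ + 1) ∧ b ≠ none ∧ b ≠ D.mid (i₀ + 1))) →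
        canonicalWeight D.M (D.ΘStage i₀) s(a, b) =
          D.evenStage (i₀ + 1) (Sym2.map (D.swapMid (i₀ + 1)) s(a, b)) by
      induction e using Sym2.ind with
      | _ a b =>
        by_cases ha : a = none ∨ a = D.mid (i₀ + 1)
        · exact key a b ht.1 ht.2.2 hs0 hs1 hs2 (by tauto)
        · by_cases hb : b = none ∨ b = D.mid (i₀ + 1)
          · have := key b a (by rw [Sym2.eq_swap]; exact ht.1) (by rw [Sym2.eq_swap]; exact ht.2.2)
              (by rw [Sym2.eq_swap]; exact hs0) (by rw [Sym2.eq_swap]; exact hs1)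
              (by rw [Sym2.eq_swap]; exact hs2) (by tauto)
            rw [Sym2.map_mk] at this ⊢
            rwa [Sym2.eq_swap, Sym2.eq_swap (a := D.swapMid _ a)]
          · push Not at ha hb
            exact key a b ht.1 ht.2.2 hs0 hs1 hs2 (Or.inr (Or.inr ⟨ha.1, ha.2, hb.1, hb.2⟩))
    intro a b h1 h3 h4 h5 h6 hwl
    rcases hwl with rfl | rfl | ⟨ha1, ha2, hb1, hb2⟩
    · -- `a = ⋆`
      rw [canonicalWeight_eq_zero_of_mem_none _ _ (Sym2.mem_mk_left _ _), Sym2.map_mk, swapMid_none]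
      cases b with
      | none => rw [swapMid_none, evenStage_succ_mid_mid]
      | some y =>
        have hy : (some y : SV) ≠ D.mid (i₀ + 1) := fun h => h5 (by rw [h])
        rw [swapMid_of_ne (Option.some_ne_none _) hy]
        by_cases hy1 : y = (i₀ + 1 + 1, D.j + 1)
        · subst hy1; exact evenStage_succ_mid_top.symm
        by_cases hy2 : y = (i₀ + 1 + 1, D.j - 1)
        · subst hy2; exact evenStage_succ_mid_bot.symm
        rw [evenStage_succ_mid_some hy1 hy2]
        refine (canonicalWeight_ΘStage_mid_of_ne _ hy1 hy2 ?_ ?_).symm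
        · intro h; apply h4; rw [h]; rfl
        · intro h; apply h6; rw [h]; rfl
    · -- `a = O_{i₀+1}`
      rw [Sym2.map_mk, swapMid_mid]
      cases b with
      | none => exact absurd Sym2.eq_swap h5
      | some y =>
        by_cases hym : (some y : SV) = D.mid (i₀ + 1)
        · rw [hym, swapMid_mid, ExchangeData.mid, canonicalWeight_diag_self, evenStage_succ_none_none]
        rw [swapMid_of_ne (Option.some_ne_none _) hym]
        have hy3 : y ≠ (i₀ + 1, D.j) := fun h => hym (by rw [h]; rfl)
        by_cases hy1 : y = (i₀ + 1 + 1, D.j + 1)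
        · subst hy1
          rw [ExchangeData.mid, canonicalWeight_ΘStage_mid_top hpar]
          exact evenStage_succ_none_top.symm
        by_cases hy2 : y = (i₀ + 1 + 1, D.j - 1)
        · subst hy2
          rw [ExchangeData.mid, canonicalWeight_ΘStage_mid_bot hpar]
          exact evenStage_succ_none_bot.symm
        rw [evenStage_succ_none_some hy1 hy2 hy3, ExchangeData.mid]
        refine canonicalWeight_ΘStage_mid_of_ne _ hy1 hy2 ?_ ?_
        · intro h; apply h3; rw [h, Sym2.eq_swap]; rfl
        · intro h; apply h1; rw [h]; rfl
    · -- both endpoints are ordinary lattice labels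
      cases a with
      | none => exact absurd rfl ha1
      | some x =>
        cases b with
        | none => exact absurd rfl hb1
        | some y =>
          have hx : x ≠ (i₀ + 1, D.j) := fun h => ha2 (by rw [h]; rfl)
          have hy : y ≠ (i₀ + 1, D.j) := fun h => hb2 (by rw [h]; rfl)
          rw [Sym2.map_mk, swapMid_of_ne ha1 ha2, swapMid_of_ne hb1 hb2,
            evenStage_succ_some_some hx hy]
          exact canonicalWeight_ΘStage_succ_odd hpar h3 h1



end Moves

/-! ### The boundary steps and the exchanged lattice -/

section Boundary

/-- The canonical weights depend on the angles of the rhombi of the strip only. [folklore] -/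
theorem canonicalWeight_congr_strip {M : ℕ} {Θ Θ' : ℤ → ℤ → ℝ}
    (h : ∀ i y, -(M : ℤ) ≤ i → i < M → Θ i y = Θ' i y) :
    canonicalWeight M Θ = canonicalWeight M Θ' := by
  have key : ∀ a b : SV, dirWeight M Θ a b = dirWeight M Θ' a b := by
    rintro (_ | a) (_ | b) <;> try rfl
    simp only [dirWeight]
    split_ifs with hA hB
    · rw [h _ _ hA.2.2.1 hA.2.2.2]
    · rw [h _ _ hB.2.2.1 hB.2.2.2]
    · rfl
  funext e
  induction e using Sym2.ind with
  | _ a b => simp only [canonicalWeight_mk, key]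

/-- At the first stage the angles are the original ones throughout the strip. [folklore] -/
theorem canonicalWeight_ΘStage_neg :
    canonicalWeight D.M (D.ΘStage (-(D.M : ℤ))) = D.initial := by
  refine canonicalWeight_congr_strip fun i y hi _ => ?_
  simp [ExchangeData.ΘStage, ExchangeData.βStage, not_lt.2 hi]

/-- The row angles after the exchange: `β_{j-1}` and `β_j` interchanged. (GM14 §5.3: "we may write
`Σ_j(G_{α,β}, P_{α,β}) = (G_{α,σ_jβ}, P_{α,σ_jβ})`".) [cite: GrimmettManolescu2014Isoradial, §5.3] -/
def βExchanged : ℤ → ℝ := D.β ∘ Equiv.swap (D.j - 1) D.j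

/-- The weights of the exchanged lattice `G_{α,σ_jβ}` in the strip. [cite: GrimmettManolescu2014Isoradial, §5.3] -/
def exchanged : Sym2 SV → unitInterval := canonicalWeight D.M fun i y => D.βExchanged y - D.α i

/-- At the last stage the angles are the exchanged ones throughout the strip. [folklore] -/
theorem canonicalWeight_ΘStage_M :
    canonicalWeight D.M (D.ΘStage D.M) = D.exchanged := by
  refine canonicalWeight_congr_strip fun i y _ hi => ?_
  simp only [ExchangeData.ΘStage, ExchangeData.βStage, hi, and_true, ExchangeData.βExchanged,
    Function.comp_apply]
  by_cases h1 : y = D.j - 1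
  · subst h1; simp [Equiv.swap_apply_left]
  · by_cases h2 : y = D.j
    · subst h2
      have h1' : ¬ (D.j = D.j - 1) := h1
      simp [h1', Equiv.swap_apply_right]
    · rw [if_neg h1, if_neg h2, Equiv.swap_apply_of_ne_of_ne h1 h2]

variable {D}

/-- **Insertion, odd case** (`-M + j` odd): the first stage is `G_{α,β}` in the strip with the extra
edge `B_{-M}T_{-M}` of weight `p_{π-(β_j-β_{j-1})}` (GM14 §5.3: "We insert a new rhombus on the left
side of the strip"). [cite: GrimmettManolescu2014Isoradial, §5.3] -/
theorem oddStage_neg :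
    D.oddStage (-(D.M : ℤ)) =
      Function.update D.initial s(D.bot (-(D.M : ℤ)), D.top (-(D.M : ℤ))) (angleWeight (π - (D.up - D.lo))) := by
  rw [ExchangeData.oddStage, canonicalWeight_ΘStage_neg, if_pos ⟨le_rfl, by omega⟩]

/-- **Insertion, even case** (`-M + j` even): the first stage is `G_{α,β}` with the old boundary
vertex `O_{-M}` renamed `⋆` and a new pendant vertex `N_{-M}` (labelled `(-M, j)`) attached to it
by the diagonal of the inserted rhombus, of weight `p_{β_j-β_{j-1}}`.
[cite: GrimmettManolescu2014Isoradial, §5.3] -/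
theorem evenStage_neg (hpar : Even (-(D.M : ℤ) + D.j)) :
    D.evenStage (-(D.M : ℤ)) =
      Function.update (D.initial ∘ Sym2.map (D.swapMid (-(D.M : ℤ)))) s(none, D.mid (-(D.M : ℤ)))
        (angleWeight (D.up - D.lo)) := by
  rw [← canonicalWeight_ΘStage_neg]
  generalize hm : -(D.M : ℤ) = m
  rw [hm] at hpar
  have hmle : -(D.M : ℤ) ≤ m := hm.le
  have hmM : m ≤ D.M := by omega
  have hodd : ¬ Even (m + (D.j - 1)) := by
    rw [Int.not_even_iff_odd]; obtain ⟨r, hr⟩ := hpar; exact ⟨r - 1, by omega⟩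
  funext e
  rw [Function.update_apply, Function.comp_apply]
  -- ordered pairs, special endpoint in front
  suffices key : ∀ a b : SV, (a = none ∨ a = D.mid m ∨ (a ≠ none ∧ a ≠ D.mid m ∧ b ≠ none ∧ b ≠ D.mid m)) →
      D.evenStage m s(a, b) = if s(a, b) = s(none, D.mid m) then angleWeight (D.up - D.lo)
        else canonicalWeight D.M (D.ΘStage m) (Sym2.map (D.swapMid m) s(a, b)) by
    induction e using Sym2.ind with
    | _ a b =>
      by_cases ha : a = none ∨ a = D.mid m
      · exact key a b (by tauto)
      · by_cases hb : b = none ∨ b = D.mid m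
        · have h := key b a (by tauto)
          have hab : s(a, b) = s(b, a) := Sym2.eq_swap
          rw [hab]
          exact h
        · push Not at ha hb
          exact key a b (Or.inr (Or.inr ⟨ha.1, ha.2, hb.1, hb.2⟩))
  intro a b hwl
  rcases hwl with rfl | rfl | ⟨ha1, ha2, hb1, hb2⟩
  · -- `a = ⋆`
    rw [Sym2.map_mk, swapMid_none]
    cases b with
    | none =>
      rw [swapMid_none, if_neg (by simp), ExchangeData.mid, canonicalWeight_diag_self, evenStage_apply,
        if_neg (by simp), if_neg (by simp), if_neg (by simp), if_neg (by simp), if_neg (by simp)]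
      exact canonicalWeight_eq_zero_of_mem_none _ _ (Sym2.mem_mk_left _ _)
    | some y =>
      by_cases hym : (some y : SV) = D.mid m
      · rw [hym, if_pos rfl, evenStage_succ_none_mid hmle hmM]
      rw [if_neg (by simpa [ExchangeData.mid] using hym), swapMid_of_ne (Option.some_ne_none _) hym]
      have hy3 : y ≠ (m, D.j) := fun h => hym (by rw [h]; rfl)
      by_cases hy1 : y = (m + 1, D.j + 1)
      · subst hy1
        change D.evenStage m s(none, D.top (m + 1)) = _
        rw [evenStage_succ_none_top, ExchangeData.mid]
        split_ifs with hs
        · rw [canonicalWeight_diag_up D.M _ hpar hs.1 hs.2]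
          simp [ExchangeData.ΘStage, ExchangeData.βStage]
        · rw [canonicalWeight_diag_up_eq_zero D.M _ (fun h => hs h.2)]
      by_cases hy2 : y = (m + 1, D.j - 1)
      · subst hy2
        change D.evenStage m s(none, D.bot (m + 1)) = _
        rw [evenStage_succ_none_bot, ExchangeData.mid,
          show ((m, D.j) : ℤ × ℤ) = (m, D.j - 1 + 1) by rw [sub_add_cancel]]
        split_ifs with hs
        · rw [canonicalWeight_diag_down D.M _ hodd hs.1 hs.2]
          have hj : ¬ (D.j - 1 = D.j) := by omega
          simp [ExchangeData.ΘStage, ExchangeData.βStage, hj]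
        · rw [canonicalWeight_diag_down_eq_zero D.M _ (fun h => hs h.2)]
      rw [evenStage_succ_none_some hy1 hy2 hy3, ExchangeData.mid]
      -- the remaining partners of `(m, j)` lie outside the strip
      by_cases hy4 : y = (m - 1, D.j - 1)
      · subst hy4
        rw [Sym2.eq_swap, show ((m, D.j) : ℤ × ℤ) = (m - 1 + 1, D.j - 1 + 1) by ring_nf,
          canonicalWeight_diag_up_eq_zero D.M _ (fun h => by omega)]
      by_cases hy5 : y = (m - 1, D.j + 1)
      · subst hy5
        rw [Sym2.eq_swap, show ((m, D.j) : ℤ × ℤ) = (m - 1 + 1, D.j) by ring_nf,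
          canonicalWeight_diag_down_eq_zero D.M _ (fun h => by omega)]
      exact (canonicalWeight_eq_zero_of_ne _ _ (by simpa using hy1) (by simpa using hy2)
        (by simpa using hy4) (by simpa using hy5)).symm
  · -- `a = (m, j)`, the new pendant vertex
    rw [Sym2.map_mk, swapMid_mid]
    cases b with
    | none =>
      rw [swapMid_none, if_pos Sym2.eq_swap, Sym2.eq_swap, evenStage_succ_none_mid hmle hmM]
    | some y =>
      rw [if_neg (by simp)]
      by_cases hym : (some y : SV) = D.mid m
      · rw [hym, swapMid_mid, evenStage_succ_mid_mid]
        exact (canonicalWeight_eq_zero_of_mem_none _ _ (Sym2.mem_mk_left _ _)).symm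
      rw [swapMid_of_ne (Option.some_ne_none _) hym,
        canonicalWeight_eq_zero_of_mem_none _ _ (Sym2.mem_mk_left _ _)]
      by_cases hy1 : y = (m + 1, D.j + 1)
      · subst hy1; exact evenStage_succ_mid_top (i := m)
      by_cases hy2 : y = (m + 1, D.j - 1)
      · subst hy2; exact evenStage_succ_mid_bot (i := m)
      rw [evenStage_succ_mid_some hy1 hy2]
      by_cases hy4 : y = (m - 1, D.j - 1)
      · subst hy4
        rw [Sym2.eq_swap, show ((m, D.j) : ℤ × ℤ) = (m - 1 + 1, D.j - 1 + 1) by ring_nf,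
          canonicalWeight_diag_up_eq_zero D.M _ (fun h => by omega)]
      by_cases hy5 : y = (m - 1, D.j + 1)
      · subst hy5
        rw [Sym2.eq_swap, show ((m, D.j) : ℤ × ℤ) = (m - 1 + 1, D.j) by ring_nf,
          canonicalWeight_diag_down_eq_zero D.M _ (fun h => by omega)]
      exact canonicalWeight_eq_zero_of_ne _ _ (by simpa using hy1) (by simpa using hy2)
        (by simpa using hy4) (by simpa using hy5)
  · -- both endpoints ordinary
    cases a with
    | none => exact absurd rfl ha1
    | some x =>
      cases b with
      | none => exact absurd rfl hb1
      | some y =>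
        have hx : x ≠ (m, D.j) := fun h => ha2 (by rw [h]; rfl)
        have hy : y ≠ (m, D.j) := fun h => hb2 (by rw [h]; rfl)
        rw [if_neg (by simp), Sym2.map_mk, swapMid_of_ne ha1 ha2, swapMid_of_ne hb1 hb2,
          evenStage_succ_some_some hx hy]

/-- **Removal, even case** (`M + j` even): deleting the pendant travelling edge at the right side of
the strip from the last stage leaves exactly the exchanged lattice `G_{α,σ_jβ}` (GM14 §5.3: "When
it reaches the right side, it is removed. In the new graph, the original tracks `s_{j-1}` and `s_j`
have been exchanged"). [cite: GrimmettManolescu2014Isoradial, §5.3] -/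
theorem update_evenStage_M :
    Function.update (D.evenStage D.M) s(none, D.mid D.M) 0 = D.exchanged := by
  rw [← canonicalWeight_ΘStage_M]
  funext e
  rw [Function.update_apply, evenStage_apply]
  have hs : ¬ (-(D.M : ℤ) ≤ D.M ∧ (D.M : ℤ) < D.M) := fun h => lt_irrefl _ h.2
  simp only [hs, if_false]
  split_ifs with h0 h1 h2 h3 h4
  · subst h0; exact (canonicalWeight_eq_zero_of_mem_none _ _ (Sym2.mem_mk_left _ _)).symm
  · subst h1; exact (canonicalWeight_eq_zero_of_mem_none _ _ (Sym2.mem_mk_left _ _)).symm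
  · subst h2; exact (canonicalWeight_eq_zero_of_mem_none _ _ (Sym2.mem_mk_left _ _)).symm
  · subst h3
    rw [ExchangeData.mid, ExchangeData.top]
    exact (canonicalWeight_diag_up_eq_zero D.M _ (fun h => lt_irrefl _ h.2.2)).symm
  · subst h4
    rw [ExchangeData.mid, ExchangeData.bot,
      show (((D.M : ℤ), D.j) : ℤ × ℤ) = ((D.M : ℤ), D.j - 1 + 1) by rw [sub_add_cancel]]
    exact (canonicalWeight_diag_down_eq_zero D.M _ (fun h => lt_irrefl _ h.2.2)).symm
  · rfl

/-- **Removal, odd case** (`M + j` odd): deleting the travelling edge `B_M T_M` from the last stage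
leaves the exchanged lattice. [cite: GrimmettManolescu2014Isoradial, §5.3] -/
theorem update_oddStage_M :
    Function.update (D.oddStage D.M) s(D.bot D.M, D.top D.M) 0 = D.exchanged := by
  rw [← canonicalWeight_ΘStage_M, ExchangeData.oddStage, Function.update_idem, Function.update_eq_self_iff,
    ExchangeData.bot, ExchangeData.top]
  exact (canonicalWeight_eq_zero_of_ne _ _ (by simp only [ne_eq, Prod.mk.injEq]; omega)
    (by simp only [ne_eq, Prod.mk.injEq]; omega) (by simp only [ne_eq, Prod.mk.injEq]; omega)
    (by simp only [ne_eq, Prod.mk.injEq]; omega)).symm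

end Boundary

/-! ### Side conditions of the moves: self-duality and non-degeneracy -/

section SideConditions

variable {D}

/-- **Self-duality of the even-stage triangle**: its three weights `p_{π-(β_j-β_{j-1})}`,
`p_{π-(β_{j-1}-α_{i₀})}`, `p_{β_j-α_{i₀}}` have angles adding up to `2π`, hence `κ_△ = 0`
(GM14 §5.2–5.3; this is what makes each step of the track exchange measure preserving).
[cite: GrimmettManolescu2014Isoradial, §5.3] -/
theorem kappa_oddStage_succ_evenTri {i₀ : ℤ} (hpar : Even (i₀ + D.j)) (hi : -(D.M : ℤ) ≤ i₀)
    (hi' : i₀ < D.M) (hlu : D.up - D.lo ∈ Set.Ioo 0 π) (hlo : D.lo - D.α i₀ ∈ Set.Ioo 0 π)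
    (hup : D.up - D.α i₀ ∈ Set.Ioo 0 π) :
    kappa (fun k => (D.oddStage (i₀ + 1) (triEdge (D.evenTri i₀) k) : ℝ)) = 0 := by
  have h : (fun k => (D.oddStage (i₀ + 1) (triEdge (D.evenTri i₀) k) : ℝ)) =
      fun k => (angleWeight (![π - (D.up - D.lo), π - (D.lo - D.α i₀), D.up - D.α i₀] k) : ℝ) := by
    funext k
    fin_cases k
    · exact congrArg Subtype.val (oddStage_succ_triEdge_zero hi hi')
    · exact congrArg Subtype.val (oddStage_succ_triEdge_one hpar hi hi')
    · exact congrArg Subtype.val (oddStage_succ_triEdge_two hpar hi hi')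
  rw [h]
  refine kappa_angleWeight_eq_zero _ (fun k => ?_) ?_
  · fin_cases k
    · exact ⟨by simp; linarith [hlu.2], by simp; linarith [hlu.1]⟩
    · exact ⟨by simp; linarith [hlo.2], by simp; linarith [hlo.1]⟩
    · simpa using hup
  · simp; ring

/-- The even-stage triangle weights are `< 1`. [cite: GrimmettManolescu2014Isoradial, §5.3] -/
theorem oddStage_succ_triEdge_lt_one {i₀ : ℤ} (hpar : Even (i₀ + D.j)) (hi : -(D.M : ℤ) ≤ i₀)
    (hi' : i₀ < D.M) (hlu : D.up - D.lo ∈ Set.Ioo 0 π) (hlo : D.lo - D.α i₀ ∈ Set.Ioo 0 π)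
    (hup : D.up - D.α i₀ ∈ Set.Ioo 0 π) (k : Fin 3) :
    (D.oddStage (i₀ + 1) (triEdge (D.evenTri i₀) k) : ℝ) < 1 := by
  fin_cases k
  · exact (congrArg Subtype.val (oddStage_succ_triEdge_zero hi hi')).trans_lt
      (coe_angleWeight_lt_one (θ := π - (D.up - D.lo)) ⟨by linarith [hlu.2], by linarith [hlu.1]⟩)
  · exact (congrArg Subtype.val (oddStage_succ_triEdge_one hpar hi hi')).trans_lt
      (coe_angleWeight_lt_one (θ := π - (D.lo - D.α i₀)) ⟨by linarith [hlo.2], by linarith [hlo.1]⟩)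
  · exact (congrArg Subtype.val (oddStage_succ_triEdge_two hpar hi hi')).trans_lt
      (coe_angleWeight_lt_one hup)

/-- **Self-duality of the odd-stage triangle** `(B_{i₀}, O_{i₀+1}, T_{i₀})`.
[cite: GrimmettManolescu2014Isoradial, §5.3] -/
theorem kappa_oddStage_oddTri {i₀ : ℤ} (hpar : ¬ Even (i₀ + D.j)) (hi : -(D.M : ℤ) ≤ i₀)
    (hi' : i₀ < D.M) (hlu : D.up - D.lo ∈ Set.Ioo 0 π) (hlo : D.lo - D.α i₀ ∈ Set.Ioo 0 π)
    (hup : D.up - D.α i₀ ∈ Set.Ioo 0 π) :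
    kappa (fun k => (D.oddStage i₀ (triEdge (D.oddTri i₀) k) : ℝ)) = 0 := by
  have h : (fun k => (D.oddStage i₀ (triEdge (D.oddTri i₀) k) : ℝ)) =
      fun k => (angleWeight (![D.up - D.α i₀, π - (D.up - D.lo), π - (D.lo - D.α i₀)] k) : ℝ) := by
    funext k
    fin_cases k
    · exact congrArg Subtype.val (oddStage_triEdge_zero hpar hi hi')
    · exact congrArg Subtype.val (oddStage_triEdge_one hi hi')
    · exact congrArg Subtype.val (oddStage_triEdge_two hpar hi hi')
  rw [h]
  refine kappa_angleWeight_eq_zero _ (fun k => ?_) ?_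
  · fin_cases k
    · simpa using hup
    · exact ⟨by simp; linarith [hlu.2], by simp; linarith [hlu.1]⟩
    · exact ⟨by simp; linarith [hlo.2], by simp; linarith [hlo.1]⟩
  · simp; ring

/-- The odd-stage triangle weights are `< 1`. [cite: GrimmettManolescu2014Isoradial, §5.3] -/
theorem oddStage_triEdge_lt_one {i₀ : ℤ} (hpar : ¬ Even (i₀ + D.j)) (hi : -(D.M : ℤ) ≤ i₀)
    (hi' : i₀ < D.M) (hlu : D.up - D.lo ∈ Set.Ioo 0 π) (hlo : D.lo - D.α i₀ ∈ Set.Ioo 0 π)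
    (hup : D.up - D.α i₀ ∈ Set.Ioo 0 π) (k : Fin 3) :
    (D.oddStage i₀ (triEdge (D.oddTri i₀) k) : ℝ) < 1 := by
  fin_cases k
  · exact (congrArg Subtype.val (oddStage_triEdge_zero hpar hi hi')).trans_lt (coe_angleWeight_lt_one hup)
  · exact (congrArg Subtype.val (oddStage_triEdge_one hi hi')).trans_lt
      (coe_angleWeight_lt_one (θ := π - (D.up - D.lo)) ⟨by linarith [hlu.2], by linarith [hlu.1]⟩)
  · exact (congrArg Subtype.val (oddStage_triEdge_two hpar hi hi')).trans_lt
      (coe_angleWeight_lt_one (θ := π - (D.lo - D.α i₀)) ⟨by linarith [hlo.2], by linarith [hlo.1]⟩)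

/-- **The even-stage move is a connective equivalence** (tree: `connEquiv_afterMove`): with the
protected vertices off `⋆` and the frozen edges off the hexagon, `P` at the odd stage `i₀ + 1` and
at the even stage `i₀` give the same probability to every connective event — GM14 §5.2: "A
star–triangle transformation maps an open path of `G` to an open path of `G'`", in the law form of
the tree. [cite: GrimmettManolescu2014Isoradial, §5.2–5.3] -/
theorem connEquiv_oddStage_succ_evenStage {W : Set SV} {E₀ : Set (Sym2 SV)} {i₀ : ℤ}
    (hpar : Even (i₀ + D.j)) (hi : -(D.M : ℤ) ≤ i₀) (hi' : i₀ < D.M) (hlu : D.up - D.lo ∈ Set.Ioo 0 π)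
    (hlo : D.lo - D.α i₀ ∈ Set.Ioo 0 π) (hup : D.up - D.α i₀ ∈ Set.Ioo 0 π) (hW : none ∉ W)
    (hE₀ : ∀ e ∈ E₀, (∀ k, e ≠ triEdge (D.evenTri i₀) k) ∧ ∀ k, e ≠ starEdge (D.evenTri i₀) none k) :
    ConnEquiv W E₀ (D.oddStage (i₀ + 1)) (D.evenStage i₀) := by
  rw [evenStage_eq_afterMove hpar hi hi' hlu hlo hup]
  exact connEquiv_afterMove (evenTri_injective i₀) (evenTri_ne_none i₀)
    (fun e he => oddStage_eq_zero_of_mem_none _ he)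
    (kappa_oddStage_succ_evenTri hpar hi hi' hlu hlo hup)
    (oddStage_succ_triEdge_lt_one hpar hi hi' hlu hlo hup) hW hE₀

/-- **The odd-stage move is a connective equivalence**: with the protected vertices off `⋆` and
off the label `(i₀+1, j)` (whose bearer changes), and the frozen edges off the hexagon and off these
two vertices, `P` at the odd stage `i₀` and at the even stage `i₀ + 1` agree on connective events
(tree: `connEquiv_afterMove` followed by `connEquiv_relabel`; DKKMO Prop. 2.11 / GM14 §5.3 for one
step of the track exchange). [cite: GrimmettManolescu2014Isoradial, §5.2–5.3] -/
theorem connEquiv_oddStage_evenStage_succ {W : Set SV} {E₀ : Set (Sym2 SV)} {i₀ : ℤ}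
    (hpar : ¬ Even (i₀ + D.j)) (hi : -(D.M : ℤ) ≤ i₀) (hi' : i₀ < D.M) (hlu : D.up - D.lo ∈ Set.Ioo 0 π)
    (hlo : D.lo - D.α i₀ ∈ Set.Ioo 0 π) (hup : D.up - D.α i₀ ∈ Set.Ioo 0 π) (hW : none ∉ W)
    (hW' : D.mid (i₀ + 1) ∉ W)
    (hE₀ : ∀ e ∈ E₀, (∀ k, e ≠ triEdge (D.oddTri i₀) k) ∧ ∀ k, e ≠ starEdge (D.oddTri i₀) none k)
    (hE₀' : ∀ e ∈ E₀, none ∉ e ∧ D.mid (i₀ + 1) ∉ e) :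
    ConnEquiv W E₀ (D.oddStage i₀) (D.evenStage (i₀ + 1)) := by
  refine (connEquiv_afterMove (oddTri_injective i₀) (oddTri_ne_none i₀)
    (fun e he => oddStage_eq_zero_of_mem_none _ he) (kappa_oddStage_oddTri hpar hi hi' hlu hlo hup)
    (oddStage_triEdge_lt_one hpar hi hi' hlu hlo hup) hW hE₀).trans ?_
  refine connEquiv_relabel (D.swapMid (i₀ + 1)) (fun u hu => swapMid_of_ne ?_ ?_) (fun e he => ?_)
    (fun e => (afterMove_oddStage hpar hi hi' hlu hlo hup e).symm)
  · rintro rfl; exact hW hu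
  · rintro rfl; exact hW' hu
  · induction e using Sym2.ind with
    | _ a b =>
      obtain ⟨h1, h2⟩ := hE₀' _ he
      rw [Sym2.map_mk, swapMid_of_ne (fun h => h1 (h ▸ Sym2.mem_mk_left _ _))
        (fun h => h2 (h ▸ Sym2.mem_mk_left _ _)), swapMid_of_ne (fun h => h1 (h ▸ Sym2.mem_mk_right _ _))
        (fun h => h2 (h ▸ Sym2.mem_mk_right _ _))]

end SideConditions

end ExchangeData


/-! ### Dictionary with the tree's `G_{α,β}` (`IsoradialSquareLatticeGM`) -/

section Dictionary

open LatticeModels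

/-- The diamond label of the site `(x, y)` of the abstract `ℤ²` of `IsoradialSquareLatticeGM`:
the primal vertex `v_{x-y, x+y}` (`gmVertex`: column `i = x - y`, height `j = x + y`).
[cite: GrimmettManolescu2014Isoradial, §4.6] -/
def gmLabel (x : Site 2) : SV := some (x 0 - x 1, x 0 + x 1)

/-- The east neighbour goes to the upper-right diamond neighbour. [folklore] -/
theorem gmLabel_add_single_zero (x : Site 2) :
    gmLabel (x + Pi.single 0 1) = some (x 0 - x 1 + 1, x 0 + x 1 + 1) := by
  simp only [gmLabel, Pi.add_apply, Pi.single_eq_same, Pi.single_eq_of_ne (one_ne_zero : (1 : Fin 2) ≠ 0)]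
  congr 1; ext <;> simp <;> ring

/-- The north neighbour goes to the upper-left diamond neighbour. [folklore] -/
theorem gmLabel_add_single_one (x : Site 2) :
    gmLabel (x + Pi.single 1 1) = some (x 0 - x 1 - 1, x 0 + x 1 + 1) := by
  simp only [gmLabel, Pi.add_apply, Pi.single_eq_same, Pi.single_eq_of_ne (zero_ne_one : (0 : Fin 2) ≠ 1)]
  congr 1; ext <;> simp <;> ring

/-- **Dictionary.** Transported along `gmLabel`, the canonical weights of this file with rhombus
angles `Θ i y = β_y - α_i` are exactly the tree's `gmWeight α β` of
`Literature.Probability.Percolation.IsoradialSquareLatticeGM` (the canonical measure `P_{α,β}` of the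
rhombic embedding `gmEmbedding α β`, `isoradialPercolation_gmEmbedding`) on the edges whose rhombus
lies in the strip `-M ≤ i < M`, and `0` elsewhere: the horizontal edge `(x,y)–(x+1,y)` is the
diagonal `v_{i,j} v_{i+1,j+1}` of `t_i ∩ s_j` (weight `criticalWeightI ((β_j - α_i)/2) =
angleWeight (π - (β_j - α_i))`), the vertical edge `(x,y)–(x,y+1)` the diagonal `v_{i,j} v_{i-1,j+1}`
of `t_{i-1} ∩ s_j` (weight `criticalWeightI ((π - (β_j - α_{i-1}))/2) = angleWeight (β_j - α_{i-1})`).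
[cite: GrimmettManolescu2014Isoradial, §4.6 (P_{α,β})] -/
theorem canonicalWeight_map_gmLabel (M : ℕ) (α β : ℤ → ℝ) (e : Sym2 (Site 2)) :
    canonicalWeight M (fun i y => β y - α i) (Sym2.map gmLabel e) =
      if -(M : ℤ) ≤ columnIndex e ∧ columnIndex e < M then Percolation.gmWeight α β e else 0 := by
  classical
  -- the two kinds of edges, from their lower-left endpoint
  have hE : ∀ x : Site 2, canonicalWeight M (fun i y => β y - α i) (Sym2.map gmLabel s(x, x + Pi.single 0 1)) =
      if -(M : ℤ) ≤ columnIndex s(x, x + Pi.single 0 1) ∧ columnIndex s(x, x + Pi.single 0 1) < M then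
        Percolation.gmWeight α β s(x, x + Pi.single 0 1) else 0 := by
    intro x
    have hpar : Even (x 0 - x 1 + (x 0 + x 1)) := ⟨x 0, by ring⟩
    have he : s(x, x + Pi.single 0 1) ∈ (zdGraph 2).edgeSet :=
      (SimpleGraph.mem_edgeSet _).2 ((zdGraph_adj_iff _ _).2 ⟨0, Or.inl rfl⟩)
    have hh : IsHorizontal s(x, x + Pi.single 0 1) := by rw [isHorizontal_mk]; simp
    rw [Sym2.map_mk, gmLabel_add_single_zero, gmLabel, columnIndex_horizontal]
    split_ifs with hs
    · rw [ExchangeData.canonicalWeight_diag_up M _ hpar hs.1 hs.2, Percolation.gmWeight, if_pos he, if_pos hh,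
        trackIndex_horizontal, columnIndex_horizontal, angleWeight, sub_sub_cancel]
    · exact ExchangeData.canonicalWeight_diag_up_eq_zero M _ (fun h => hs h.2)
  have hN : ∀ x : Site 2, canonicalWeight M (fun i y => β y - α i) (Sym2.map gmLabel s(x, x + Pi.single 1 1)) =
      if -(M : ℤ) ≤ columnIndex s(x, x + Pi.single 1 1) ∧ columnIndex s(x, x + Pi.single 1 1) < M then
        Percolation.gmWeight α β s(x, x + Pi.single 1 1) else 0 := by
    intro x
    have hpar : ¬ Even (x 0 - x 1 - 1 + (x 0 + x 1)) := by
      rw [Int.not_even_iff_odd]; exact ⟨x 0 - 1, by ring⟩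
    have he : s(x, x + Pi.single 1 1) ∈ (zdGraph 2).edgeSet :=
      (SimpleGraph.mem_edgeSet _).2 ((zdGraph_adj_iff _ _).2 ⟨1, Or.inl rfl⟩)
    have hh : ¬ IsHorizontal s(x, x + Pi.single 1 1) := by rw [isHorizontal_mk]; simp
    rw [Sym2.map_mk, gmLabel_add_single_one, gmLabel, columnIndex_vertical, Sym2.eq_swap,
      show ((x 0 - x 1, x 0 + x 1) : ℤ × ℤ) = (x 0 - x 1 - 1 + 1, x 0 + x 1) by rw [sub_add_cancel]]
    split_ifs with hs
    · rw [ExchangeData.canonicalWeight_diag_down M _ hpar hs.1 hs.2, Percolation.gmWeight, if_pos he, if_neg hh,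
        trackIndex_vertical, columnIndex_vertical, angleWeight]
    · exact ExchangeData.canonicalWeight_diag_down_eq_zero M _ (fun h => hs h.2)
  induction e using Sym2.ind with
  | _ x y =>
    by_cases hadj : (zdGraph 2).Adj x y
    · obtain ⟨i, h | h⟩ := (zdGraph_adj_iff x y).1 hadj
      · subst h
        fin_cases i
        · exact hE x
        · exact hN x
      · subst h
        rw [Sym2.eq_swap]
        fin_cases i
        · exact hE y
        · exact hN y
    · -- not an edge: both sides vanish
      have hne : s(x, y) ∉ (zdGraph 2).edgeSet := fun h => hadj ((SimpleGraph.mem_edgeSet _).1 h)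
      rw [Percolation.gmWeight, if_neg hne, ite_self, Sym2.map_mk, gmLabel, gmLabel]
      have hx : ∀ (a b : ℤ), y = x + Pi.single 0 a + Pi.single 1 b →
          (a = 1 ∧ b = 0) ∨ (a = 0 ∧ b = 1) ∨ (a = -1 ∧ b = 0) ∨ (a = 0 ∧ b = -1) → False := by
        rintro a b rfl habs
        apply hadj
        rw [zdGraph_adj_iff]
        rcases habs with ⟨rfl, rfl⟩ | ⟨rfl, rfl⟩ | ⟨rfl, rfl⟩ | ⟨rfl, rfl⟩
        · exact ⟨0, Or.inl (by simp)⟩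
        · exact ⟨1, Or.inl (by simp)⟩
        · exact ⟨0, Or.inr (by ext k; fin_cases k <;> simp)⟩
        · exact ⟨1, Or.inr (by ext k; fin_cases k <;> simp)⟩
      have hy : y = x + Pi.single 0 (y 0 - x 0) + Pi.single 1 (y 1 - x 1) := by
        ext k; fin_cases k <;> simp
      refine ExchangeData.canonicalWeight_eq_zero_of_ne M _ ?_ ?_ ?_ ?_ <;>
      · intro h
        simp only [Prod.mk.injEq] at h
        refine hx (y 0 - x 0) (y 1 - x 1) hy ?_
        omega

end Dictionary

end TrackExchange

end Literature.Probability.Percolation
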